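import Mathlib.Analysis.Distribution.SchwartzSpace.Fourier
import Mathlib.Analysis.Fourier.Inversion
import Mathlib.Analysis.Fourier.Convolution
import Mathlib.Analysis.Fourier.FourierTransformDeriv
import Mathlib.Analysis.Calculus.IteratedDeriv.Lemmas
import Mathlib.MeasureTheory.Measure.Haar.NormedSpace
import Literature.NumberTheory.LFunctions.BondarenkoHeap2026Section2
import HarnessLib

/-!
# Bondarenko–Heap 2026, §2 — proofs of the calculus facts (2), (3): `supp Ŵ_T ⊆ [−2σ/T, 2σ/T]`,
# `C_Φ > 0`, `Ŵ_T(0) = C_Φ T + O_{Φ,B}(T⁻¹)`, and of the extension of the integrals to `ℝ` (p. 6)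

LABEL (cell `rh-crit`, corpus C5 `ah`): **NOT RH-BEARING.** This file PROVES four of the named facts of
`Literature/NumberTheory/LFunctions/BondarenkoHeap2026Section2.lean` (the statement layer of §2 of
[BondarenkoHeap2026], arXiv:2608.07399v1, p. 5, displays (2)–(3), TeX l.236–250, and p. 6, TeX l.269–281):

* `BondarenkoHeap2026.cPhi_pos_holds : cPhi_pos` — `C_Φ = ∫ x^{2B}{Φ(x−1)² + Φ(x+1)²} dx > 0`;
* `BondarenkoHeap2026.weightHat_zero_holds : weightHat_zero` — `|Ŵ_T(0) − C_Φ T| ≤ K/T` for `T ≥ 1`;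
* `BondarenkoHeap2026.extensionToLine_holds : extensionToLine` — `𝓘₀ > 0` and
  `|𝓘₁/𝓘₀ − I₁/I₀| ≤ K T^{−C}` for `B ≥ B₀(ε, C, C_L)`, `T ≥ T₀`, given `I₀ ≥ 1` (unconditional; the
  "extension of the integrals in (1) and (2) from `[T^{1−ε}, T^{1+ε}]` to `ℝ`" of p. 6);
* `BondarenkoHeap2026.weightHat_support_holds : weightHat_support` — (2): `𝓕 W_T(ξ) = 0` for
  `|ξ| > 2σ/T` (`T > 0`): `𝓕(Φ²) = φ ∗ φ` (Mathlib's `Real.fourier_mul_convolution_eq` through Fourier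
  inversion) is supported in `[−2σ, 2σ]`, the affine substitution `t ↦ t/T ± 1` rescales to `2σ/T`, and
  the polynomial prefactor acts as a differential operator on the Fourier side (`Real.iteratedDeriv_fourier`),
  preserving vanishing on the open set `{|ξ| > 2σ/T}` (namespace `Support`).

Both are RH-free calculus about the bump `φ ∈ C_c^∞((−σ,σ))` (real, even, nonzero) and
`Φ = 𝓕⁻φ`: `φ` is a Schwartz function (`HasCompactSupport.toSchwartzMap`), hence so is `𝓕⁻φ`
(Mathlib's Fourier transform on `𝓢(ℝ, ℂ)`), which gives the decay needed for the integrability of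
`x^k Φ(x + a)²`; Fourier inversion (`Continuous.fourier_fourierInv_eq`) gives `Φ ≢ 0`; and
`∫ W_T = T ∫ (x² + 1/(4T²))^B {Φ(x−1)² + Φ(x+1)²} dx` (substitution `t = Tx`) expands binomially into
`C_Φ T + T Σ_{j<B} C(B,j) (4T²)^{−(B−j)} m_j` with the moments `m_j = ∫ x^{2j}{Φ(x−1)² + Φ(x+1)²} ≥ 0`.
For the extension to `ℝ` (namespace `Extension`): `|R(t)| ≤ A L^{1+ε}` trivially, `N_h(t) ≤ C₁ log(|t|+4)`
for `h ≤ 2` from the tree's unit-window count `Montgomery.exists_zetaZeroCount_window_le`, `N_h(t) = 0`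
for `t ≤ 0` (no ordinates below `14`), `W_T(t) ≤ (2a²/T²)^B · 2‖Φ‖²_∞` for `|t| ≤ a` and the Schwartz
tail `W_T(t) ≤ D (T/|t|)^{2B}` for `|t| ≥ 2T`; the symmetry of the zeros (`g = |R|²W_T` even) turns
`I₀, I₁` into twice the window integrals plus nonnegative errors `≪ T^{4C_L + 4 − 2εB}`, and the tails are
evaluated with `∫_b^∞ t^{−s} dt` (`integral_Ioi_rpow_of_lt`).
Nothing here bears on the truth of RH. No definitions, no new named facts.

## References

* [BondarenkoHeap2026] A. Bondarenko, W. Heap, arXiv:2608.07399v1, §2.1, display (3) and the line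
  after it (p. 5; TeX l.241–250); display (2) "`Ŵ_T(ξ) = 0` if `|ξ| ≥ 2σ/T`" (p. 5; TeX l.236–240);
  the paragraph "we would like to extend the integrals in (1) and (2) … Here we have assumed `I₀ ≫ 1`"
  (p. 6; TeX l.269–281).
-/

noncomputable section

open Filter MeasureTheory Set
open scoped Real FourierTransform ContDiff

namespace Literature.NumberTheory.LFunctions

namespace BondarenkoHeap2026

namespace WeightCalculus

/-- `φ`, viewed as a complex-valued function, is smooth. [cite: BondarenkoHeap2026, §2.1 p. 5 (φ and σ)] -/
theorem contDiff_phiC (w : Bump) : ContDiff ℝ ∞ fun ξ : ℝ ↦ (w.φ ξ : ℂ) :=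
  Complex.ofRealCLM.contDiff.comp w.smooth

/-- `φ`, viewed as a complex-valued function, has compact support. [cite: BondarenkoHeap2026, §2.1 p. 5 (φ and σ)] -/
theorem hasCompactSupport_phiC (w : Bump) : HasCompactSupport fun ξ : ℝ ↦ (w.φ ξ : ℂ) :=
  w.hasCompactSupport.comp_left Complex.ofReal_zero

/-- **`Φ` is a Schwartz function**: there is `Φs ∈ 𝓢(ℝ, ℂ)` (namely `𝓕⁻` of the Schwartz function
`φ`) with `Φ(x) = Φs(x)` for all real `x`. [cite: BondarenkoHeap2026, §2.1 p. 5 (Φ)] -/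
theorem exists_schwartz_Phi (w : Bump) :
    ∃ Φs : SchwartzMap ℝ ℂ, ∀ x : ℝ, (Phi w x : ℂ) = Φs x := by
  refine ⟨𝓕⁻ ((hasCompactSupport_phiC w).toSchwartzMap (contDiff_phiC w)), fun x ↦ ?_⟩
  rw [Phi_eq, SchwartzMap.fourierInv_coe]
  rfl

/-- `Φ` is bounded. [cite: BondarenkoHeap2026, §2.1 p. 5 (Φ)] -/
theorem exists_bound_Phi (w : Bump) : ∃ C : ℝ, 0 ≤ C ∧ ∀ x : ℝ, |Phi w x| ≤ C := by
  obtain ⟨Φs, hΦ⟩ := exists_schwartz_Phi w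
  obtain ⟨C, hC0, hC⟩ := Φs.decay 0 0
  refine ⟨C, hC0.le, fun x ↦ ?_⟩
  have h := hC x
  simp only [pow_zero, one_mul, norm_iteratedFDeriv_zero] at h
  calc |Phi w x| = ‖(Phi w x : ℂ)‖ := by rw [Complex.norm_real, Real.norm_eq_abs]
    _ = ‖Φs x‖ := by rw [hΦ x]
    _ ≤ C := h

/-- `|x|^k ≤ 2^k (|x + a|^k + |a|^k)`. [folklore] -/
private theorem abs_pow_le_two_pow (x a : ℝ) (k : ℕ) :
    |x| ^ k ≤ 2 ^ k * (|x + a| ^ k + |a| ^ k) := by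
  have h1 : |x| ≤ |x + a| + |a| := by
    calc |x| = |(x + a) - a| := by ring_nf
      _ ≤ |x + a| + |a| := abs_sub _ _
  have hm0 : 0 ≤ max |x + a| |a| := le_trans (abs_nonneg _) (le_max_left _ _)
  have h2 : |x| ≤ 2 * max |x + a| |a| := by
    have := le_max_left |x + a| |a|
    have := le_max_right |x + a| |a|
    linarith
  have hmax : (max |x + a| |a|) ^ k ≤ |x + a| ^ k + |a| ^ k := by
    rcases le_total |x + a| |a| with h | h
    · rw [max_eq_right h]; linarith [pow_nonneg (abs_nonneg (x + a)) k]
    · rw [max_eq_left h]; linarith [pow_nonneg (abs_nonneg a) k]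
  calc |x| ^ k ≤ (2 * max |x + a| |a|) ^ k := pow_le_pow_left₀ (abs_nonneg x) h2 k
    _ = 2 ^ k * (max |x + a| |a|) ^ k := mul_pow 2 _ k
    _ ≤ 2 ^ k * (|x + a| ^ k + |a| ^ k) := by gcongr

/-- **Integrability of the moments**: `x ↦ x^k Φ(x + a)²` is integrable on `ℝ` for every `k ∈ ℕ`,
`a ∈ ℝ` (Schwartz decay of `Φ`). [cite: BondarenkoHeap2026, §2.1 (3) p. 5] -/
theorem integrable_pow_mul_Phi_sq (w : Bump) (k : ℕ) (a : ℝ) :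
    Integrable fun x : ℝ ↦ x ^ k * Phi w (x + a) ^ 2 := by
  obtain ⟨Φs, hΦ⟩ := exists_schwartz_Phi w
  obtain ⟨C, hC0, hC⟩ := exists_bound_Phi w
  have hnorm : ∀ y : ℝ, |Phi w y| = ‖Φs y‖ := fun y ↦ by
    rw [← hΦ y, Complex.norm_real, Real.norm_eq_abs]
  have hg1 : Integrable fun x : ℝ ↦ ‖x + a‖ ^ k * ‖Φs (x + a)‖ :=
    (Φs.integrable_pow_mul volume k).comp_add_right a
  have hg2 : Integrable fun x : ℝ ↦ ‖Φs (x + a)‖ := Φs.integrable.norm.comp_add_right a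
  refine Integrable.mono' ((hg1.add (hg2.const_mul (|a| ^ k))).const_mul (C * 2 ^ k)) ?_ ?_
  · exact ((continuous_pow k).mul
      (((continuous_Phi w).comp (continuous_id.add continuous_const)).pow 2)).aestronglyMeasurable
  · refine Eventually.of_forall fun x ↦ ?_
    rw [Real.norm_eq_abs, abs_mul, abs_pow, pow_two, abs_mul]
    have hx := abs_pow_le_two_pow x a k
    have hΦ1 : |Phi w (x + a)| ≤ C := hC _
    have hΦΦ : |Phi w (x + a)| * |Phi w (x + a)| ≤ C * ‖Φs (x + a)‖ := by
      rw [← hnorm]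
      exact mul_le_mul_of_nonneg_right hΦ1 (abs_nonneg _)
    calc |x| ^ k * (|Phi w (x + a)| * |Phi w (x + a)|)
        ≤ (2 ^ k * (|x + a| ^ k + |a| ^ k)) * (C * ‖Φs (x + a)‖) :=
          mul_le_mul hx hΦΦ (by positivity) (by positivity)
      _ = C * 2 ^ k * (‖x + a‖ ^ k * ‖Φs (x + a)‖ + |a| ^ k * ‖Φs (x + a)‖) := by
          rw [Real.norm_eq_abs]; ring

/-- The moments `x ↦ x^{2j} {Φ(x−1)² + Φ(x+1)²}` are integrable. [cite: BondarenkoHeap2026, §2.1 (3) p. 5] -/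
theorem integrable_moment (w : Bump) (k : ℕ) :
    Integrable fun x : ℝ ↦ x ^ k * (Phi w (x - 1) ^ 2 + Phi w (x + 1) ^ 2) := by
  have h1 := integrable_pow_mul_Phi_sq w k (-1)
  have h2 := integrable_pow_mul_Phi_sq w k 1
  have h := h1.add h2
  refine h.congr (Eventually.of_forall fun x ↦ ?_)
  simp only [Pi.add_apply, ← sub_eq_add_neg]
  ring

/-- **`Φ` is not identically zero** (Fourier inversion: `𝓕(𝓕⁻φ) = φ`, and `φ ≠ 0`).
[cite: BondarenkoHeap2026, §2.1 p. 5 (Φ)] -/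
theorem exists_Phi_ne_zero (w : Bump) : ∃ x : ℝ, Phi w x ≠ 0 := by
  by_contra h
  push Not at h
  apply w.ne_zero
  have hzero : 𝓕⁻ (fun ξ : ℝ ↦ (w.φ ξ : ℂ)) = 0 := by
    funext x
    have hx := Phi_eq w x
    rw [h x, Complex.ofReal_zero] at hx
    exact hx.symm
  have hcont : Continuous fun ξ : ℝ ↦ (w.φ ξ : ℂ) := Complex.continuous_ofReal.comp w.smooth.continuous
  have hFint : Integrable (𝓕 (fun ξ : ℝ ↦ (w.φ ξ : ℂ))) := by
    have hI := (𝓕 ((hasCompactSupport_phiC w).toSchwartzMap (contDiff_phiC w)) :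
      SchwartzMap ℝ ℂ).integrable (μ := volume)
    rw [SchwartzMap.fourier_coe] at hI
    exact hI
  have hinv := hcont.fourier_fourierInv_eq w.integrable hFint
  rw [hzero] at hinv
  have h0 : 𝓕 (0 : ℝ → ℂ) = 0 := by
    ext ξ
    simp [Real.fourier_real_eq_integral_exp_smul]
  rw [h0] at hinv
  funext ξ
  have hξ := congr_fun hinv ξ
  simp only [Pi.zero_apply] at hξ
  exact_mod_cast hξ.symm

end WeightCalculus

open WeightCalculus in
/-- **DISCHARGE of (3), positivity: `C_Φ > 0`.** The integrand `x^{2B}{Φ(x−1)² + Φ(x+1)²}` is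
continuous, non-negative, integrable, and positive somewhere (`Φ ≢ 0`), so its integral is
positive. [cite: BondarenkoHeap2026, §2.1 (3) p. 5] -/
theorem cPhi_pos_holds : cPhi_pos := by
  intro w B
  obtain ⟨x₀, hx₀⟩ := exists_Phi_ne_zero w
  set f : ℝ → ℝ := fun x ↦ x ^ (2 * B) * (Phi w (x - 1) ^ 2 + Phi w (x + 1) ^ 2) with hf
  have hfi : Integrable f := integrable_moment w (2 * B)
  have hfc : Continuous f :=
    (continuous_pow _).mul ((((continuous_Phi w).comp (continuous_id.sub continuous_const)).pow 2).add
      (((continuous_Phi w).comp (continuous_id.add continuous_const)).pow 2))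
  have hfnn : ∀ x, 0 ≤ f x := fun x ↦
    mul_nonneg ((even_two_mul B).pow_nonneg x) (add_nonneg (sq_nonneg _) (sq_nonneg _))
  have hsq : 0 < Phi w x₀ ^ 2 := by positivity
  -- a point where `f > 0`
  have hpt : ∃ x₁, 0 < f x₁ := by
    by_cases h1 : x₀ + 1 = 0
    · refine ⟨x₀ - 1, ?_⟩
      have hne : x₀ - 1 ≠ 0 := by intro h; linarith
      have harg : x₀ - 1 + 1 = x₀ := by ring
      simp only [hf, harg]
      exact mul_pos ((even_two_mul B).pow_pos hne) (add_pos_of_nonneg_of_pos (sq_nonneg _) hsq)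
    · refine ⟨x₀ + 1, ?_⟩
      have harg : x₀ + 1 - 1 = x₀ := by ring
      simp only [hf, harg]
      exact mul_pos ((even_two_mul B).pow_pos h1) (add_pos_of_pos_of_nonneg hsq (sq_nonneg _))
  show 0 < ∫ x, f x
  rw [integral_pos_iff_support_of_nonneg (fun x ↦ hfnn x) hfi]
  obtain ⟨x₁, hx₁⟩ := hpt
  exact hfc.isOpen_support.measure_pos volume ⟨x₁, Function.mem_support.mpr hx₁.ne'⟩

open WeightCalculus in
/-- `Ŵ_T(0) = ∫ W_T` (the Fourier transform at `0`). [cite: BondarenkoHeap2026, §2.1 (3) p. 5] -/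
theorem weightHat_zero_eq_integral (w : Bump) (B : ℕ) (T : ℝ) :
    weightHat w B T 0 = ∫ t, weight w B T t := by
  rw [weightHat, Real.fourier_real_eq_integral_exp_smul]
  simp only [mul_zero, Complex.ofReal_zero, zero_mul, Complex.exp_zero, one_smul]
  rw [integral_complex_ofReal, Complex.ofReal_re]

open WeightCalculus in
/-- **DISCHARGE of (3): `Ŵ_T(0) = C_Φ T + O_{Φ,B}(T⁻¹)`.** With `g = Φ(·−1)² + Φ(·+1)²` and the
moments `m_j = ∫ x^{2j} g ≥ 0`: `Ŵ_T(0) = ∫ W_T = T ∫ (x² + 1/(4T²))^B g = T Σ_j C(B,j)(4T²)^{−(B−j)} m_j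
= C_Φ T + T Σ_{j<B} C(B,j)(4T²)^{−(B−j)} m_j`, and for `T ≥ 1` the last sum is at most
`(4T²)^{−1} Σ_{j<B} C(B,j) m_j`, whence `|Ŵ_T(0) − C_Φ T| ≤ K/T` with `K = ¼ Σ_{j<B} C(B,j) m_j`.
[cite: BondarenkoHeap2026, §2.1 (3) p. 5] -/
theorem weightHat_zero_holds : weightHat_zero := by
  intro w B
  set g : ℝ → ℝ := fun x ↦ Phi w (x - 1) ^ 2 + Phi w (x + 1) ^ 2 with hg
  have hgi : ∀ j : ℕ, Integrable fun x : ℝ ↦ x ^ (2 * j) * g x := fun j ↦ integrable_moment w (2 * j)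
  set m : ℕ → ℝ := fun j ↦ ∫ x, x ^ (2 * j) * g x with hm
  have hm0 : ∀ j, 0 ≤ m j := fun j ↦ integral_nonneg fun x ↦
    mul_nonneg ((even_two_mul j).pow_nonneg x) (add_nonneg (sq_nonneg _) (sq_nonneg _))
  have hcPhi : cPhi w B = m B := rfl
  set S : ℝ := ∑ j ∈ Finset.range B, (B.choose j : ℝ) * m j with hS
  have hS0 : 0 ≤ S := Finset.sum_nonneg fun j _ ↦ mul_nonneg (Nat.cast_nonneg _) (hm0 j)
  refine ⟨S / 4, fun T hT ↦ ?_⟩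
  have hT0 : 0 < T := by linarith
  set a : ℝ := 1 / (4 * T ^ 2) with ha
  have ha0 : 0 ≤ a := by positivity
  have ha1 : a ≤ 1 := by
    rw [ha, div_le_one (by positivity)]; nlinarith
  -- Step 1: `∫ W_T = T ∫ (x² + a)^B g`
  have hbase : ∀ t : ℝ, (t ^ 2 + 1 / 4) / T ^ 2 = (t / T) ^ 2 + a := fun t ↦ by
    rw [ha]; field_simp; try ring
  have hF : (fun t : ℝ ↦ weight w B T t) = fun t ↦ (fun x : ℝ ↦ (x ^ 2 + a) ^ B * g x) (T⁻¹ * t) := by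
    funext t
    simp only [weight, hg, inv_mul_eq_div, hbase]
  have hint : ∫ t, weight w B T t = T * ∫ x, (x ^ 2 + a) ^ B * g x := by
    rw [hF]
    have h := Measure.integral_comp_inv_mul_left (fun x : ℝ ↦ (x ^ 2 + a) ^ B * g x) T
    rw [abs_of_pos hT0, smul_eq_mul] at h
    exact h
  -- Step 2: binomial expansion and termwise integration
  have hexp : (fun x : ℝ ↦ (x ^ 2 + a) ^ B * g x) =
      fun x ↦ ∑ j ∈ Finset.range (B + 1), (B.choose j : ℝ) * a ^ (B - j) * (x ^ (2 * j) * g x) := by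
    funext x
    rw [add_pow, Finset.sum_mul]
    refine Finset.sum_congr rfl fun j _ ↦ ?_
    rw [← pow_mul, mul_comm 2 j]
    ring
  have hsum : ∫ x, (x ^ 2 + a) ^ B * g x =
      ∑ j ∈ Finset.range (B + 1), (B.choose j : ℝ) * a ^ (B - j) * m j := by
    rw [hexp, integral_finsetSum _ (fun j _ ↦ (hgi j).const_mul _)]
    refine Finset.sum_congr rfl fun j _ ↦ ?_
    rw [integral_const_mul]
  rw [Finset.sum_range_succ, Nat.choose_self, Nat.sub_self, pow_zero, Nat.cast_one, one_mul,
    one_mul] at hsum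
  -- the remainder `R = Σ_{j<B} C(B,j) a^{B-j} m_j`, with `0 ≤ R ≤ a S`
  set R : ℝ := ∑ j ∈ Finset.range B, (B.choose j : ℝ) * a ^ (B - j) * m j with hR
  have hR0 : 0 ≤ R := Finset.sum_nonneg fun j _ ↦
    mul_nonneg (mul_nonneg (Nat.cast_nonneg _) (pow_nonneg ha0 _)) (hm0 j)
  have hRle : R ≤ a * S := by
    rw [hR, hS, Finset.mul_sum]
    refine Finset.sum_le_sum fun j hj ↦ ?_
    have hjB : j < B := Finset.mem_range.mp hj
    have hpow : a ^ (B - j) ≤ a := pow_le_of_le_one ha0 ha1 (by omega)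
    calc (B.choose j : ℝ) * a ^ (B - j) * m j ≤ (B.choose j : ℝ) * a * m j :=
          mul_le_mul_of_nonneg_right (mul_le_mul_of_nonneg_left hpow (Nat.cast_nonneg _)) (hm0 j)
      _ = a * ((B.choose j : ℝ) * m j) := by ring
  -- conclude
  rw [weightHat_zero_eq_integral, hint, hsum, hcPhi]
  have hdiff : T * (R + m B) - m B * T = T * R := by ring
  rw [hdiff, abs_of_nonneg (mul_nonneg hT0.le hR0)]
  calc T * R ≤ T * (a * S) := by gcongr
    _ = S / 4 * T⁻¹ := by rw [ha]; field_simp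


/-! ### Appended (prover phase): towards the extension lemma `extensionToLine` — helper estimates

Bookkeeping for p. 6 of [BondarenkoHeap2026] (TeX l.269–281): the trivial bounds
`|R(t)| ≤ A L^{1+ε}`, `N_h(t) ≪ log(|t|+2)` (tree `Montgomery.exists_zetaZeroCount_window_le`),
`N_h(t) = 0` for `t ≤ 0`, the evenness `|R(−t)| = |R(t)|`, integrability of `W_T` and `|t| W_T`,
and the two size estimates for `W_T`: `W_T(t) ≤ (2a²/T²)^B · 2‖Φ‖_∞²` for `|t| ≤ a` and the Schwartz
tail `W_T(t) ≤ D (T/|t|)^{2B}` for `|t| ≥ 2T`. NOT RH-BEARING. -/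

namespace Extension

/-- `∫ f(−t) dt = ∫ f(t) dt` on `ℝ`. [folklore] -/
private theorem integral_comp_neg_real (f : ℝ → ℝ) : ∫ t, f (-t) = ∫ t, f t := by
  have h := Measure.integral_comp_mul_left f (-1)
  simp only [neg_mul, one_mul, inv_neg, inv_one, abs_neg, abs_one, one_smul] at h
  exact h

/-- `R(−t) = conj R(t)` for real coefficients. [cite: BondarenkoHeap2026, §2.1 p. 5 (R(t))] -/
theorem dirichletPoly_neg (r : ℕ → ℝ) (L t : ℝ) :
    dirichletPoly r L (-t) = (starRingEnd ℂ) (dirichletPoly r L t) := by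
  unfold dirichletPoly
  rw [map_sum]
  refine Finset.sum_congr rfl fun n hn ↦ ?_
  have hn1 : 1 ≤ n := (Finset.mem_Icc.mp hn).1
  rw [map_mul, Complex.conj_ofReal]
  congr 1
  have harg : ((n : ℂ)).arg ≠ π := by
    rw [Complex.natCast_arg]; exact Real.pi_ne_zero.symm
  have h := Complex.cpow_conj (n : ℂ) (-(1 / 2 : ℂ) - t * Complex.I) harg
  rw [Complex.conj_natCast] at h
  rw [← h]
  congr 1
  simp only [map_sub, map_neg, map_div₀, map_one, map_mul, Complex.conj_ofReal, Complex.conj_I,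
    Complex.ofReal_neg, map_ofNat]
  ring

/-- `|R(−t)| = |R(t)|` for real coefficients. [cite: BondarenkoHeap2026, §2.1 p. 5 (R(t))] -/
theorem norm_dirichletPoly_neg (r : ℕ → ℝ) (L t : ℝ) :
    ‖dirichletPoly r L (-t)‖ = ‖dirichletPoly r L t‖ := by
  rw [dirichletPoly_neg, Complex.norm_conj]

/-- The trivial bound `|R(t)| ≤ A L^{1+ε}` for `|r(n)| ≤ A n^ε`, `L ≥ 1` ("`R(t)² ≪ L^{1+ε}`" on p. 6,
in crude form). [cite: BondarenkoHeap2026, §2.1 p. 6 (extension to ℝ)] -/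
theorem norm_dirichletPoly_le {r : ℕ → ℝ} {A ε L : ℝ} (hA : 0 ≤ A) (hε : 0 ≤ ε) (hL : 1 ≤ L)
    (hr : ∀ n : ℕ, 1 ≤ n → |r n| ≤ A * (n : ℝ) ^ ε) (t : ℝ) :
    ‖dirichletPoly r L t‖ ≤ A * L ^ (1 + ε) := by
  unfold dirichletPoly
  have hL0 : 0 < L := by linarith
  have hfloor : (⌊L⌋₊ : ℝ) ≤ L := Nat.floor_le hL0.le
  calc ‖∑ n ∈ Finset.Icc 1 ⌊L⌋₊, (r n : ℂ) * (n : ℂ) ^ (-(1 / 2 : ℂ) - t * Complex.I)‖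
      ≤ ∑ n ∈ Finset.Icc 1 ⌊L⌋₊, ‖(r n : ℂ) * (n : ℂ) ^ (-(1 / 2 : ℂ) - t * Complex.I)‖ :=
        norm_sum_le _ _
    _ ≤ ∑ n ∈ Finset.Icc 1 ⌊L⌋₊, A * L ^ ε := by
        refine Finset.sum_le_sum fun n hn ↦ ?_
        have hn1 : 1 ≤ n := (Finset.mem_Icc.mp hn).1
        have hnL : (n : ℝ) ≤ L := le_trans (by exact_mod_cast (Finset.mem_Icc.mp hn).2) hfloor
        have hn0 : 0 < n := by omega
        rw [norm_mul, Complex.norm_real, Real.norm_eq_abs, Complex.norm_natCast_cpow_of_pos hn0]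
        have hre : (-(1 / 2 : ℂ) - t * Complex.I).re = -(1 / 2) := by simp
        rw [hre]
        have hpow : (n : ℝ) ^ (-(1 / 2 : ℝ)) ≤ 1 :=
          Real.rpow_le_one_of_one_le_of_nonpos (by exact_mod_cast hn1) (by norm_num)
        have hnε : (n : ℝ) ^ ε ≤ L ^ ε := Real.rpow_le_rpow (by positivity) hnL hε
        calc |r n| * (n : ℝ) ^ (-(1 / 2 : ℝ)) ≤ A * (n : ℝ) ^ ε * 1 :=
              mul_le_mul (hr n hn1) hpow (by positivity) (by positivity)
          _ ≤ A * L ^ ε := by rw [mul_one]; gcongr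
    _ = (⌊L⌋₊ : ℝ) * (A * L ^ ε) := by rw [Finset.sum_const, Nat.card_Icc, nsmul_eq_mul]; norm_num
    _ ≤ L * (A * L ^ ε) := by gcongr
    _ = A * L ^ (1 + ε) := by rw [Real.rpow_add hL0, Real.rpow_one]; ring

/-- **`N_h(t) ≪ log(|t| + 2)`** (p. 6), uniformly for `0 ≤ h ≤ 2`: from the tree's unit-window bound
`N(u+1) − N(u) ≤ C₀ log(|u|+2)`. [cite: BondarenkoHeap2026, §2.1 p. 6 (extension to ℝ)] -/
theorem exists_windowCount_le_log :
    ∃ C₁ : ℝ, 0 < C₁ ∧ ∀ h t : ℝ, 0 ≤ h → h ≤ 2 → windowCount h t ≤ C₁ * Real.log (|t| + 4) := by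
  obtain ⟨C₀, hC₀, hwin⟩ := Montgomery.exists_zetaZeroCount_window_le
  refine ⟨2 * C₀, by positivity, fun h t hh0 hh2 ↦ ?_⟩
  have h1 := hwin (t - h / 2)
  have h2 := hwin (t - h / 2 + 1)
  have hmono : (zetaZeroCount (t + h / 2) : ℝ) ≤ zetaZeroCount (t - h / 2 + 1 + 1) := by
    exact_mod_cast zetaZeroCount_mono (by linarith)
  have hh' : |h / 2| ≤ 1 := by rw [abs_of_nonneg (by linarith)]; linarith
  have hu1 : |t - h / 2| ≤ |t| + 1 := by
    have := abs_sub t (h / 2)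
    linarith
  have hu2 : |t - h / 2 + 1| ≤ |t| + 2 := by
    have := abs_add_le (t - h / 2) 1
    rw [abs_one] at this
    linarith
  have hl1 : Real.log (|t - h / 2| + 2) ≤ Real.log (|t| + 4) :=
    Real.log_le_log (by positivity) (by linarith)
  have hl2 : Real.log (|t - h / 2 + 1| + 2) ≤ Real.log (|t| + 4) :=
    Real.log_le_log (by positivity) (by linarith)
  have hm1 := mul_le_mul_of_nonneg_left hl1 hC₀.le
  have hm2 := mul_le_mul_of_nonneg_left hl2 hC₀.le
  unfold windowCount
  linarith

/-- `N_h(t) = 0` for `t ≤ 0` and `h ≤ 2` (no ordinates below `14`).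
[cite: BondarenkoHeap2026, §2.1 p. 6 (extension to ℝ)] -/
theorem windowCount_eq_zero_of_nonpos {h t : ℝ} (hh0 : 0 ≤ h) (hh2 : h ≤ 2) (ht : t ≤ 0) :
    windowCount h t = 0 := by
  have h14 : (14 : ℝ) < zetaOrdinate 0 := fourteen_lt_zetaOrdinate_zero_holds
  have hN : ∀ x : ℝ, x ≤ 1 → zetaZeroCount x = 0 := fun x hx ↦
    Nat.le_zero.mp (Montgomery.lt_zetaOrdinate_iff.mp (by linarith))
  unfold windowCount
  rw [hN _ (by linarith), hN _ (by linarith)]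
  simp

/-- `N_h` is measurable (difference of monotone functions). [cite: BondarenkoHeap2026, §2.1 p. 4 (N_h)] -/
theorem measurable_windowCount (h : ℝ) : Measurable (windowCount h) := by
  unfold windowCount
  refine Measurable.sub ?_ ?_
  · exact (Monotone.measurable fun a b hab ↦ by exact_mod_cast zetaZeroCount_mono (by linarith))
  · exact (Monotone.measurable fun a b hab ↦ by exact_mod_cast zetaZeroCount_mono (by linarith))

end Extension

namespace Extension

/-- `W_T` is integrable on `ℝ` (for `T > 0`). [cite: BondarenkoHeap2026, §2.1 (1) p. 5] -/
theorem integrable_weight (w : Bump) (B : ℕ) {T : ℝ} (hT : 0 < T) :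
    Integrable fun t : ℝ ↦ weight w B T t := by
  set a : ℝ := 1 / (4 * T ^ 2) with ha
  set g : ℝ → ℝ := fun x ↦ Phi w (x - 1) ^ 2 + Phi w (x + 1) ^ 2 with hg
  have hbase : ∀ t : ℝ, (t ^ 2 + 1 / 4) / T ^ 2 = (t / T) ^ 2 + a := fun t ↦ by
    rw [ha]; field_simp; try ring
  have hF : (fun t : ℝ ↦ weight w B T t) = fun t ↦ (fun x : ℝ ↦ (x ^ 2 + a) ^ B * g x) (T⁻¹ * t) := by
    funext t
    simp only [weight, hg, inv_mul_eq_div, hbase]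
  have hexp : (fun x : ℝ ↦ (x ^ 2 + a) ^ B * g x) =
      fun x ↦ ∑ j ∈ Finset.range (B + 1), (B.choose j : ℝ) * a ^ (B - j) * (x ^ (2 * j) * g x) := by
    funext x
    rw [add_pow, Finset.sum_mul]
    refine Finset.sum_congr rfl fun j _ ↦ ?_
    rw [← pow_mul, mul_comm 2 j]
    ring
  have hFi : Integrable fun x : ℝ ↦ (x ^ 2 + a) ^ B * g x := by
    rw [hexp]
    exact integrable_finsetSum _ fun j _ ↦ (WeightCalculus.integrable_moment w (2 * j)).const_mul _
  rw [hF]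
  exact hFi.comp_mul_left' (inv_ne_zero hT.ne')

/-- `|t| W_T(t)` is integrable on `ℝ` (for `T > 0`). [cite: BondarenkoHeap2026, §2.1 (1) p. 5] -/
theorem integrable_abs_mul_weight (w : Bump) (B : ℕ) {T : ℝ} (hT : 0 < T) :
    Integrable fun t : ℝ ↦ |t| * weight w B T t := by
  set a : ℝ := 1 / (4 * T ^ 2) with ha
  set g : ℝ → ℝ := fun x ↦ Phi w (x - 1) ^ 2 + Phi w (x + 1) ^ 2 with hg
  have hg0 : ∀ x, 0 ≤ g x := fun x ↦ add_nonneg (sq_nonneg _) (sq_nonneg _)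
  have hbase : ∀ t : ℝ, (t ^ 2 + 1 / 4) / T ^ 2 = (t / T) ^ 2 + a := fun t ↦ by
    rw [ha]; field_simp; try ring
  have hF : (fun t : ℝ ↦ |t| * weight w B T t) =
      fun t ↦ (fun x : ℝ ↦ T * (|x| * ((x ^ 2 + a) ^ B * g x))) (T⁻¹ * t) := by
    funext t
    simp only [weight, hg, inv_mul_eq_div, hbase]
    rw [abs_div, abs_of_pos hT]
    field_simp
  have hexp : (fun x : ℝ ↦ |x| * ((x ^ 2 + a) ^ B * g x)) =
      fun x ↦ ∑ j ∈ Finset.range (B + 1), (B.choose j : ℝ) * a ^ (B - j) * ‖x ^ (2 * j + 1) * g x‖ := by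
    funext x
    rw [add_pow, Finset.sum_mul, Finset.mul_sum]
    refine Finset.sum_congr rfl fun j _ ↦ ?_
    rw [Real.norm_eq_abs, abs_mul, abs_of_nonneg (hg0 x), abs_pow, pow_succ |x| (2 * j), pow_mul |x| 2 j,
      sq_abs]
    ring
  have hFi : Integrable fun x : ℝ ↦ |x| * ((x ^ 2 + a) ^ B * g x) := by
    rw [hexp]
    exact integrable_finsetSum _ fun j _ ↦
      ((WeightCalculus.integrable_moment w (2 * j + 1)).norm).const_mul _
  rw [hF]
  exact (hFi.const_mul T).comp_mul_left' (inv_ne_zero hT.ne')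

/-- `W_T(t) ≤ (2a²/T²)^B · 2C²` for `|t| ≤ a` (`a ≥ 1`, `|Φ| ≤ C`). [cite: BondarenkoHeap2026, §2.1 (1) p. 5] -/
theorem weight_le_of_abs_le (w : Bump) (B : ℕ) {C T a t : ℝ} (hC : ∀ x, |Phi w x| ≤ C) (hT : 0 < T)
    (ha : 1 ≤ a) (ht : |t| ≤ a) :
    weight w B T t ≤ (2 * a ^ 2 / T ^ 2) ^ B * (2 * C ^ 2) := by
  have hC0 : 0 ≤ C := le_trans (abs_nonneg _) (hC 0)
  have hsq : ∀ y, Phi w y ^ 2 ≤ C ^ 2 := fun y ↦ by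
    have h := abs_le.mp (hC y)
    exact sq_le_sq' h.1 h.2
  unfold weight
  refine mul_le_mul ?_ ?_ (by positivity) (by positivity)
  · refine pow_le_pow_left₀ (by positivity) ?_ B
    rw [div_le_div_iff_of_pos_right (by positivity)]
    have : t ^ 2 ≤ a ^ 2 := by
      rw [← sq_abs t]; exact pow_le_pow_left₀ (abs_nonneg t) ht 2
    nlinarith
  · linarith [hsq (t / T - 1), hsq (t / T + 1)]

/-- **Schwartz tail of `W_T`**: `W_T(t) ≤ D (T/|t|)^{2B}` for `|t| ≥ 2T`, `T ≥ 1`.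
[cite: BondarenkoHeap2026, §2.1 (1) p. 5] -/
theorem exists_weight_tail_bound (w : Bump) (B : ℕ) :
    ∃ D : ℝ, 0 ≤ D ∧ ∀ T t : ℝ, 1 ≤ T → 2 * T ≤ |t| →
      weight w B T t ≤ D * (T / |t|) ^ (2 * B) := by
  obtain ⟨Φs, hΦ⟩ := WeightCalculus.exists_schwartz_Phi w
  obtain ⟨CM, hCM0, hCM⟩ := Φs.decay (2 * B) 0
  have hnorm : ∀ y : ℝ, |Phi w y| = ‖Φs y‖ := fun y ↦ by
    rw [← hΦ y, Complex.norm_real, Real.norm_eq_abs]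
  -- `|Φ(y)| ≤ CM / |y|^{2B}` for `y ≠ 0`
  have hdec : ∀ y : ℝ, 0 < |y| → |Phi w y| ≤ CM / |y| ^ (2 * B) := by
    intro y hy
    have h := hCM y
    rw [norm_iteratedFDeriv_zero, Real.norm_eq_abs, ← hnorm] at h
    rw [le_div_iff₀ (pow_pos hy _)]
    linarith [mul_comm (|y| ^ (2 * B)) (|Phi w y|)]
  refine ⟨2 ^ B * (2 * (CM * 2 ^ (2 * B)) ^ 2), by positivity, fun T t hT ht ↦ ?_⟩
  have hT0 : 0 < T := by linarith
  set u : ℝ := |t| / T with hu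
  have hu2 : 2 ≤ u := by rw [hu, le_div_iff₀ hT0]; linarith
  have hu0 : 0 < u := by linarith
  have hxt : |t / T| = u := by rw [abs_div, abs_of_pos hT0]
  -- the two shifted arguments have absolute value `≥ u/2`
  have hy : ∀ s : ℝ, s = 1 ∨ s = -1 → u / 2 ≤ |t / T + s| := by
    intro s hs
    have h1 : |t / T| - |s| ≤ |t / T + s| := by
      have := abs_add_le (t / T + s) (-s)
      rw [abs_neg] at this
      have h' : t / T + s + -s = t / T := by ring
      rw [h'] at this
      linarith
    have hs1 : |s| = 1 := by rcases hs with rfl | rfl <;> simp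
    rw [hxt, hs1] at h1
    linarith
  have hΦb : ∀ s : ℝ, s = 1 ∨ s = -1 → Phi w (t / T + s) ^ 2 ≤ (CM * (2 / u) ^ (2 * B)) ^ 2 := by
    intro s hs
    have hys := hy s hs
    have hy0 : 0 < |t / T + s| := by linarith
    have h1 : |Phi w (t / T + s)| ≤ CM * (2 / u) ^ (2 * B) := by
      refine (hdec _ hy0).trans ?_
      rw [div_eq_mul_inv CM, ← inv_pow]
      refine mul_le_mul_of_nonneg_left ?_ hCM0.le
      refine pow_le_pow_left₀ (by positivity) ?_ _
      rw [le_div_iff₀ hu0, inv_mul_eq_div, div_le_iff₀ hy0]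
      linarith
    have h2 := abs_le.mp h1
    exact sq_le_sq' h2.1 h2.2
  -- the polynomial prefactor
  have hpre : (t ^ 2 + 1 / 4) / T ^ 2 ≤ 2 * u ^ 2 := by
    have h1 : (t ^ 2 + 1 / 4) / T ^ 2 = u ^ 2 + 1 / (4 * T ^ 2) := by
      rw [hu]; field_simp; rw [sq_abs]; try ring
    rw [h1]
    have h2 : 1 / (4 * T ^ 2) ≤ 1 / 4 := by
      rw [div_le_div_iff_of_pos_left one_pos (by positivity) (by positivity)]; nlinarith
    nlinarith
  have hmain : weight w B T t ≤ (2 * u ^ 2) ^ B * (2 * (CM * (2 / u) ^ (2 * B)) ^ 2) := by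
    unfold weight
    refine mul_le_mul (pow_le_pow_left₀ (by positivity) hpre B) ?_ (by positivity) (by positivity)
    have h1 := hΦb 1 (Or.inl rfl)
    have h2 := hΦb (-1) (Or.inr rfl)
    have e1 : t / T - 1 = t / T + -1 := by ring
    rw [e1]
    linarith
  refine hmain.trans (le_of_eq ?_)
  have hTt : T / |t| = u⁻¹ := by rw [hu, inv_div]
  have e1 : (2 * u ^ 2) ^ B = 2 ^ B * u ^ (2 * B) := by rw [mul_pow, pow_mul]
  have e2 : (2 / u) ^ (2 * B) = 2 ^ (2 * B) * u⁻¹ ^ (2 * B) := by rw [div_eq_mul_inv, mul_pow]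
  have hu1 : u ^ (2 * B) * u⁻¹ ^ (2 * B) = 1 := by
    rw [← mul_pow, mul_inv_cancel₀ hu0.ne', one_pow]
  rw [hTt, e1, e2]
  linear_combination (2 ^ B * (2 * (CM * 2 ^ (2 * B)) ^ 2) * u⁻¹ ^ (2 * B)) * hu1

end Extension

namespace Extension

/-- **Symmetry of the zeros / evenness bookkeeping** (p. 6): for an even integrable `g ≥ 0` and
`0 < a`, `0 ≤ ∫_ℝ g − 2∫_{[a,b]} g ≤ ∫_{[−a,a]} g + 2 ∫_{(b,∞)} g`.
[cite: BondarenkoHeap2026, §2.1 p. 6 (extension to ℝ)] -/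
theorem even_decomp {g : ℝ → ℝ} (hgi : Integrable g) (heven : ∀ t, g (-t) = g t)
    (hg0 : ∀ t, 0 ≤ g t) {a : ℝ} (b : ℝ) (ha : 0 < a) :
    0 ≤ (∫ t, g t) - 2 * ∫ t in Set.Icc a b, g t ∧
    (∫ t, g t) - 2 * ∫ t in Set.Icc a b, g t ≤
      (∫ t in Set.Icc (-a) a, g t) + 2 * ∫ t in Set.Ioi b, g t := by
  set S : Set ℝ := Set.Icc a b with hS_def
  have hs_int : Integrable (S.indicator g) := hgi.indicator measurableSet_Icc
  have hs'_int : Integrable (fun t ↦ S.indicator g (-t)) := hs_int.comp_neg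
  have hp_int : Integrable ((Set.Icc (-a) a).indicator g) := hgi.indicator measurableSet_Icc
  have hq_int : Integrable ((Set.Ioi b).indicator g) := hgi.indicator measurableSet_Ioi
  have hq'_int : Integrable (fun t ↦ (Set.Ioi b).indicator g (-t)) := hq_int.comp_neg
  have hS : ∫ t, S.indicator g t = ∫ t in S, g t := integral_indicator measurableSet_Icc
  have hS' : ∫ t, S.indicator g (-t) = ∫ t in S, g t := by
    rw [integral_comp_neg_real (S.indicator g), hS]
  have hP : ∫ t, (Set.Icc (-a) a).indicator g t = ∫ t in Set.Icc (-a) a, g t :=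
    integral_indicator measurableSet_Icc
  have hQ : ∫ t, (Set.Ioi b).indicator g t = ∫ t in Set.Ioi b, g t :=
    integral_indicator measurableSet_Ioi
  have hQ' : ∫ t, (Set.Ioi b).indicator g (-t) = ∫ t in Set.Ioi b, g t := by
    rw [integral_comp_neg_real ((Set.Ioi b).indicator g), hQ]
  have hle : ∀ (U : Set ℝ) (t : ℝ), U.indicator g t ≤ g t := fun U t ↦
    Set.indicator_le_self' (fun x _ ↦ hg0 x) t
  have hnn : ∀ (U : Set ℝ) (t : ℝ), 0 ≤ U.indicator g t := fun U t ↦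
    Set.indicator_nonneg (fun x _ ↦ hg0 x) t
  have P1 : ∀ t, S.indicator g t + S.indicator g (-t) ≤ g t := by
    intro t
    by_cases ht : t ∈ S
    · have hnt : -t ∉ S := fun h ↦ by
        have h1 := h.1; have h2 := ht.1; linarith
      rw [Set.indicator_of_mem ht, Set.indicator_of_notMem hnt, add_zero]
    · rw [Set.indicator_of_notMem ht, zero_add, ← heven t]; exact hle S (-t)
  have P2 : ∀ t, g t ≤ S.indicator g t + S.indicator g (-t) +
      ((Set.Icc (-a) a).indicator g t + (Set.Ioi b).indicator g t +
        (Set.Ioi b).indicator g (-t)) := by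
    intro t
    have h1 := hnn S t; have h2 := hnn S (-t); have h3 := hnn (Set.Icc (-a) a) t
    have h4 := hnn (Set.Ioi b) t; have h5 := hnn (Set.Ioi b) (-t)
    by_cases ht : t ∈ S
    · rw [Set.indicator_of_mem ht]; linarith
    by_cases hnt : -t ∈ S
    · rw [Set.indicator_of_mem hnt, heven]; linarith
    by_cases hta : t ∈ Set.Icc (-a) a
    · rw [Set.indicator_of_mem hta]; linarith
    simp only [hS_def, Set.mem_Icc, not_and_or, not_le] at ht hnt hta
    rcases hta with hta | hta
    · have hb' : b < -t := by
        rcases hnt with h | h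
        · linarith
        · exact h
      rw [Set.indicator_of_mem (show -t ∈ Set.Ioi b from hb'), heven]; linarith
    · have hb' : b < t := by
        rcases ht with h | h
        · linarith
        · exact h
      rw [Set.indicator_of_mem (show t ∈ Set.Ioi b from hb')]; linarith
  have hsum_int : Integrable (fun t ↦ S.indicator g t + S.indicator g (-t)) := hs_int.add hs'_int
  have hpq_int : Integrable (fun t ↦ (Set.Icc (-a) a).indicator g t + (Set.Ioi b).indicator g t) :=
    hp_int.add hq_int
  have hrest_int : Integrable (fun t ↦ (Set.Icc (-a) a).indicator g t +
      (Set.Ioi b).indicator g t + (Set.Ioi b).indicator g (-t)) := hpq_int.add hq'_int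
  constructor
  · have h1 : ∫ t, (S.indicator g t + S.indicator g (-t)) ≤ ∫ t, g t :=
      integral_mono hsum_int hgi P1
    rw [integral_add hs_int hs'_int, hS, hS'] at h1
    linarith
  · have h1 : ∫ t, g t ≤ ∫ t, (S.indicator g t + S.indicator g (-t) +
        ((Set.Icc (-a) a).indicator g t + (Set.Ioi b).indicator g t +
          (Set.Ioi b).indicator g (-t))) :=
      integral_mono hgi (hsum_int.add hrest_int) P2
    rw [integral_add hsum_int hrest_int, integral_add hs_int hs'_int,
      integral_add hpq_int hq'_int, integral_add hp_int hq_int, hS, hS', hP, hQ, hQ'] at h1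
    linarith

/-- One-sided bookkeeping (p. 6): for an integrable `G ≥ 0` vanishing on `t ≤ 0`,
`0 ≤ ∫_ℝ G − ∫_{[a,b]} G ≤ ∫_{[0,a]} G + ∫_{(b,∞)} G`.
[cite: BondarenkoHeap2026, §2.1 p. 6 (extension to ℝ)] -/
theorem pos_decomp {G : ℝ → ℝ} (hGi : Integrable G) (hG0 : ∀ t, 0 ≤ G t)
    (hGz : ∀ t, t ≤ 0 → G t = 0) (a b : ℝ) :
    0 ≤ (∫ t, G t) - ∫ t in Set.Icc a b, G t ∧
    (∫ t, G t) - ∫ t in Set.Icc a b, G t ≤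
      (∫ t in Set.Icc 0 a, G t) + ∫ t in Set.Ioi b, G t := by
  set S : Set ℝ := Set.Icc a b with hS_def
  have hs_int : Integrable (S.indicator G) := hGi.indicator measurableSet_Icc
  have hp_int : Integrable ((Set.Icc 0 a).indicator G) := hGi.indicator measurableSet_Icc
  have hq_int : Integrable ((Set.Ioi b).indicator G) := hGi.indicator measurableSet_Ioi
  have hS : ∫ t, S.indicator G t = ∫ t in S, G t := integral_indicator measurableSet_Icc
  have hP : ∫ t, (Set.Icc 0 a).indicator G t = ∫ t in Set.Icc 0 a, G t :=
    integral_indicator measurableSet_Icc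
  have hQ : ∫ t, (Set.Ioi b).indicator G t = ∫ t in Set.Ioi b, G t :=
    integral_indicator measurableSet_Ioi
  have hle : ∀ (U : Set ℝ) (t : ℝ), U.indicator G t ≤ G t := fun U t ↦
    Set.indicator_le_self' (fun x _ ↦ hG0 x) t
  have hnn : ∀ (U : Set ℝ) (t : ℝ), 0 ≤ U.indicator G t := fun U t ↦
    Set.indicator_nonneg (fun x _ ↦ hG0 x) t
  have P2 : ∀ t, G t ≤ S.indicator G t +
      ((Set.Icc 0 a).indicator G t + (Set.Ioi b).indicator G t) := by
    intro t
    have h1 := hnn S t; have h3 := hnn (Set.Icc 0 a) t; have h4 := hnn (Set.Ioi b) t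
    by_cases ht : t ∈ S
    · rw [Set.indicator_of_mem ht]; linarith
    by_cases ht0 : t ≤ 0
    · rw [hGz t ht0]; linarith
    have ht0' : 0 < t := not_le.mp ht0
    by_cases hta : t ∈ Set.Icc 0 a
    · rw [Set.indicator_of_mem hta]; linarith
    simp only [hS_def, Set.mem_Icc, not_and_or, not_le] at ht hta
    have hb' : b < t := by
      rcases hta with h | h
      · linarith
      · rcases ht with h' | h'
        · linarith
        · exact h'
    rw [Set.indicator_of_mem (show t ∈ Set.Ioi b from hb')]; linarith
  have hpq_int : Integrable (fun t ↦ (Set.Icc 0 a).indicator G t + (Set.Ioi b).indicator G t) :=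
    hp_int.add hq_int
  constructor
  · have h1 : ∫ t, S.indicator G t ≤ ∫ t, G t := integral_mono hs_int hGi fun t ↦ hle S t
    rw [hS] at h1
    linarith
  · have h1 : ∫ t, G t ≤ ∫ t, (S.indicator G t +
        ((Set.Icc 0 a).indicator G t + (Set.Ioi b).indicator G t)) :=
      integral_mono hGi (hs_int.add hpq_int) P2
    rw [integral_add hs_int hpq_int, integral_add hp_int hq_int, hS, hP, hQ] at h1
    linarith

end Extension

set_option maxHeartbeats 800000 in -- one long bookkeeping proof (≈ 3.5·10⁵ heartbeats)
open Extension WeightCalculus in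
/-- **DISCHARGE of the extension to `ℝ`** (p. 6, TeX l.269–281): `𝓘₀ > 0` and
`|𝓘₁/𝓘₀ − I₁/I₀| ≤ K T^{−C}` for `B ≥ B₀(ε, C, C_L)`, `T ≥ T₀`, assuming `I₀ ≥ 1`.
Proof as printed: with `g = |R|² W_T ≥ 0` (even) and `N_h ≪ log(|t|+2)`, `N_h(t) = 0` for `t ≤ 0`,
the symmetry of the zeros gives `I₀ = 2𝓘₀ + e₀`, `I₁ = 2𝓘₁ + e₁` with `0 ≤ e₀, e₁` bounded by the
contributions of `|t| ≤ T^{1−ε}` (where `W_T ≤ (2T^{−2ε})^B · 2‖Φ‖²_∞`) and `|t| ≥ T^{1+ε}` (where the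
Schwartz decay gives `W_T(t) ≤ D (T/|t|)^{2B}`), against `|R|² ≤ A² L^{2+2ε} ≤ A² T^{4C_L}`; both are
`≪ T^{4C_L+4−2εB}`, and `|𝓘₁/𝓘₀ − I₁/I₀| = |𝓘₁e₀ − 𝓘₀e₁|/(𝓘₀ I₀) ≤ (sup N_h) e₀ + e₁ ≪ T^{4C_L+6−2εB}
≤ T^{−C}` once `2εB ≥ 4C_L + 7 + C`. [cite: BondarenkoHeap2026, §2.1 p. 6 (extension to ℝ)] -/
theorem extensionToLine_holds : extensionToLine := by
  intro c ε C CL A hc hε hε1 hC hCL hA w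
  obtain ⟨CΦ, hCΦ0, hCΦ⟩ := exists_bound_Phi w
  obtain ⟨C₁, hC₁0, hC₁⟩ := exists_windowCount_le_log
  refine ⟨⌈(4 * CL + 7 + C) / (2 * ε)⌉₊ + 2, fun B hB ↦ ?_⟩
  have hB2 : 2 ≤ B := le_trans (Nat.le_add_left 2 _) hB
  have hBR : (2 : ℝ) ≤ B := by exact_mod_cast hB2
  have hBε : 4 * CL + 7 + C ≤ 2 * ε * B := by
    have h1 : ((⌈(4 * CL + 7 + C) / (2 * ε)⌉₊ : ℕ) : ℝ) + 2 ≤ B := by exact_mod_cast hB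
    have h2 := Nat.le_ceil ((4 * CL + 7 + C) / (2 * ε))
    rw [div_le_iff₀ (by positivity)] at h2
    nlinarith
  obtain ⟨D, hD0, hD⟩ := exists_weight_tail_bound w B
  obtain ⟨Q₀, hQ₀_def⟩ : ∃ Q₀ : ℝ, Q₀ = A ^ 2 * (4 * 2 ^ B * CΦ ^ 2 + 2 * D) := ⟨_, rfl⟩
  have hQ₀0 : 0 ≤ Q₀ := by rw [hQ₀_def]; positivity
  obtain ⟨E, hE_def⟩ : ∃ E : ℝ, E = 4 * CL + 4 - 2 * ε * B := ⟨_, rfl⟩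
  have hEle : E ≤ -C - 3 := by rw [hE_def]; linarith
  refine ⟨8 * C₁ * Q₀, max (max 2 (Real.exp (π * c))) (max ((2 : ℝ) ^ (1 / ε)) (2 * Q₀ + 1)),
    fun T hT L hL1 hLT r hr hI0R1 ↦ ?_⟩
  have hT2 : 2 ≤ T := le_trans (le_trans (le_max_left _ _) (le_max_left _ _)) hT
  have hTexp : Real.exp (π * c) ≤ T :=
    le_trans (le_trans (le_max_right _ _) (le_max_left _ _)) hT
  have hT2ε : (2 : ℝ) ^ (1 / ε) ≤ T :=
    le_trans (le_trans (le_max_left _ _) (le_max_right _ _)) hT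
  have hTQ : 2 * Q₀ + 1 ≤ T := le_trans (le_trans (le_max_right _ _) (le_max_right _ _)) hT
  have hT0 : 0 < T := by linarith
  have hT1 : 1 ≤ T := by linarith
  -- power bookkeeping
  have hTmono : ∀ x y : ℝ, x ≤ y → T ^ x ≤ T ^ y := fun x y h ↦
    Real.rpow_le_rpow_of_exponent_le hT1 h
  have hTadd : ∀ x y : ℝ, T ^ x * T ^ y = T ^ (x + y) := fun x y ↦ (Real.rpow_add hT0 x y).symm
  have hTpos : ∀ x : ℝ, 0 < T ^ x := fun x ↦ Real.rpow_pos_of_pos hT0 x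
  -- names
  set a : ℝ := T ^ (1 - ε) with ha_def
  set b : ℝ := T ^ (1 + ε) with hb_def
  set d : ℝ := gapWidth c T with hd_def
  set M : ℝ := A ^ 2 * T ^ (4 * CL) with hM_def
  set mA : ℝ := (2 * a ^ 2 / T ^ 2) ^ B * (2 * CΦ ^ 2) with hmA_def
  set g : ℝ → ℝ := fun t ↦ ‖dirichletPoly r L t‖ ^ 2 * weight w B T t with hg_def
  set G : ℝ → ℝ := fun t ↦ windowCount d t * g t with hG_def
  have hI0 : I0 ε w B r L T = ∫ t in Set.Icc a b, g t := rfl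
  have hI1 : I1 c ε w B r L T = ∫ t in Set.Icc a b, G t := rfl
  have hI0R : I0R w B r L T = ∫ t, g t := rfl
  have hI1R : I1R c w B r L T = ∫ t, symWindowCount d t * g t := rfl
  -- basic inequalities between a, b, T
  have ha1 : 1 ≤ a := Real.one_le_rpow hT1 (by linarith)
  have ha0 : 0 < a := by linarith
  have haT : a ≤ T := by
    calc a = T ^ (1 - ε) := rfl
      _ ≤ T ^ (1 : ℝ) := hTmono _ _ (by linarith)
      _ = T := Real.rpow_one T
  have hab : a ≤ b := hTmono _ _ (by linarith)
  have hb1 : 1 ≤ b := le_trans ha1 hab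
  have hb0 : 0 < b := by linarith
  have hTε : 2 ≤ T ^ ε := by
    have h1 : ((2 : ℝ) ^ (1 / ε)) ^ ε ≤ T ^ ε := Real.rpow_le_rpow (by positivity) hT2ε hε.le
    have h2 : ((2 : ℝ) ^ (1 / ε)) ^ ε = 2 := by
      rw [← Real.rpow_mul (by norm_num : (0 : ℝ) ≤ 2), one_div_mul_cancel hε.ne', Real.rpow_one]
    linarith
  have hb2T : 2 * T ≤ b := by
    have h1 : b = T ^ (1 : ℝ) * T ^ ε := by rw [hb_def, hTadd]
    rw [h1, Real.rpow_one]; nlinarith only [hTε, hT0]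
  have hbT2 : b ≤ T ^ 2 := by
    calc b ≤ T ^ (2 : ℝ) := hTmono _ _ (by linarith)
      _ = T ^ 2 := Real.rpow_two T
  have hT21 : 1 ≤ T ^ 2 := by nlinarith only [hT1]
  -- the gap width
  have hd0 : 0 ≤ d := gapWidth_nonneg hc.le hT1
  have hd2 : d ≤ 2 := by
    have hlogpos : 0 < Real.log T := Real.log_pos (by linarith)
    have hlog : π * c ≤ Real.log T := (Real.le_log_iff_exp_le hT0).mpr hTexp
    show 2 * π * c / Real.log T ≤ 2
    rw [div_le_iff₀ hlogpos]; linarith only [hlog]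
  -- `|R|² ≤ M`
  have hM0 : 0 ≤ M := by positivity
  have hRM : ∀ t, ‖dirichletPoly r L t‖ ^ 2 ≤ M := by
    intro t
    have h1 := norm_dirichletPoly_le hA hε.le hL1 hr t
    have hL0 : 0 ≤ L := by linarith
    have h2 : L ^ (1 + ε) ≤ T ^ (2 * CL) := by
      calc L ^ (1 + ε) ≤ (T ^ CL) ^ (1 + ε) := Real.rpow_le_rpow hL0 hLT (by linarith)
        _ = T ^ (CL * (1 + ε)) := (Real.rpow_mul hT0.le CL (1 + ε)).symm
        _ ≤ T ^ (2 * CL) := hTmono _ _ (by nlinarith only [hCL, hε1])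
    have h3 : ‖dirichletPoly r L t‖ ≤ A * T ^ (2 * CL) :=
      h1.trans (mul_le_mul_of_nonneg_left h2 hA)
    have h4 : 2 * CL + 2 * CL = 4 * CL := by ring
    calc ‖dirichletPoly r L t‖ ^ 2 ≤ (A * T ^ (2 * CL)) ^ 2 := pow_le_pow_left₀ (norm_nonneg _) h3 2
      _ = A ^ 2 * (T ^ (2 * CL) * T ^ (2 * CL)) := by ring
      _ = M := by rw [hTadd, h4]
  have hW0 : ∀ t, 0 ≤ weight w B T t := weight_nonneg w B T
  have hg0 : ∀ t, 0 ≤ g t := fun t ↦ mul_nonneg (sq_nonneg _) (hW0 t)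
  have hgW : ∀ t, g t ≤ M * weight w B T t := fun t ↦
    mul_le_mul_of_nonneg_right (hRM t) (hW0 t)
  have hg_even : ∀ t, g (-t) = g t := fun t ↦ by
    simp only [hg_def, norm_dirichletPoly_neg, weight_even]
  have hg_cont : Continuous g :=
    ((continuous_dirichletPoly r L).norm.pow 2).mul (continuous_weight w B T)
  have hg_int : Integrable g :=
    ((integrable_weight w B hT0).const_mul M).mono' hg_cont.aestronglyMeasurable
      (ae_of_all _ fun t ↦ by rw [Real.norm_eq_abs, abs_of_nonneg (hg0 t)]; exact hgW t)
  -- window counts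
  have hwc0 : ∀ t, 0 ≤ windowCount d t := windowCount_nonneg hd0
  have hwcle : ∀ t, windowCount d t ≤ C₁ * (|t| + 3) := fun t ↦ by
    have h1 := hC₁ d t hd0 hd2
    have h2 : Real.log (|t| + 4) ≤ |t| + 3 := by
      have := Real.log_le_sub_one_of_pos (by positivity : 0 < |t| + 4); linarith
    exact h1.trans (mul_le_mul_of_nonneg_left h2 hC₁0.le)
  have hwcz : ∀ t, t ≤ 0 → windowCount d t = 0 := fun t ht ↦
    windowCount_eq_zero_of_nonpos hd0 hd2 ht
  have hG0 : ∀ t, 0 ≤ G t := fun t ↦ mul_nonneg (hwc0 t) (hg0 t)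
  have hGz : ∀ t, t ≤ 0 → G t = 0 := fun t ht ↦ by simp only [hG_def, hwcz t ht, zero_mul]
  have hG_meas : AEStronglyMeasurable G :=
    (measurable_windowCount d).aestronglyMeasurable.mul hg_cont.aestronglyMeasurable
  have hG_int : Integrable G := by
    refine Integrable.mono' (((integrable_abs_mul_weight w B hT0).const_mul (C₁ * M)).add
      ((integrable_weight w B hT0).const_mul (3 * C₁ * M))) hG_meas (ae_of_all _ fun t ↦ ?_)
    rw [Real.norm_eq_abs, abs_of_nonneg (hG0 t)]
    calc G t = windowCount d t * g t := rfl
      _ ≤ C₁ * (|t| + 3) * (M * weight w B T t) :=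
          mul_le_mul (hwcle t) (hgW t) (hg0 t) (by positivity)
      _ = C₁ * M * (|t| * weight w B T t) + 3 * C₁ * M * weight w B T t := by ring
  -- `I₁ = 2 ∫ N_h g` (evenness of `g`)
  have hGneg_int : Integrable (fun t ↦ G (-t)) := hG_int.comp_neg
  have hI1R2 : I1R c w B r L T = 2 * ∫ t, G t := by
    rw [hI1R]
    have h1 : (fun t ↦ symWindowCount d t * g t) = fun t ↦ G t + G (-t) := by
      funext t
      simp only [symWindowCount, hG_def, hg_even, add_mul]
    rw [h1, integral_add hG_int hGneg_int, integral_comp_neg_real G]; ring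
  -- the error terms
  obtain ⟨e₀, he₀_def⟩ : ∃ e : ℝ, e = I0R w B r L T - 2 * I0 ε w B r L T := ⟨_, rfl⟩
  obtain ⟨e₁, he₁_def⟩ : ∃ e : ℝ, e = I1R c w B r L T - 2 * I1 c ε w B r L T := ⟨_, rfl⟩
  have hdec₀ := even_decomp hg_int hg_even hg0 b ha0
  have hdec₁ := pos_decomp hG_int hG0 hGz a b
  rw [← hI0R, ← hI0, ← he₀_def] at hdec₀
  rw [← hI1] at hdec₁
  have he₁_eq : e₁ = 2 * ((∫ t, G t) - I1 c ε w B r L T) := by rw [he₁_def, hI1R2]; ring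
  -- size of `W_T` on `|t| ≤ a`
  have hmA0 : 0 ≤ mA := by positivity
  have hWsmall : ∀ t, |t| ≤ a → weight w B T t ≤ mA := fun t ht ↦
    weight_le_of_abs_le w B hCΦ hT0 ha1 ht
  -- (S1) `∫_{[−a,a]} g ≤ M mA · 2a`
  have hS1 : ∫ t in Set.Icc (-a) a, g t ≤ M * mA * (2 * a) := by
    have h1 : ∀ t ∈ Set.Icc (-a) a, ‖g t‖ ≤ M * mA := fun t ht ↦ by
      rw [Real.norm_eq_abs, abs_of_nonneg (hg0 t)]
      exact (hgW t).trans (mul_le_mul_of_nonneg_left (hWsmall t (abs_le.mpr ht)) hM0)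
    have h2 := norm_setIntegral_le_of_norm_le_const
      (measure_Icc_lt_top : volume (Set.Icc (-a) a) < ⊤) h1
    rw [Real.volume_real_Icc_of_le (by linarith), Real.norm_eq_abs] at h2
    have h3 : a - -a = 2 * a := by ring
    rw [h3] at h2
    exact (le_abs_self _).trans h2
  -- (S2) `∫_{[0,a]} N_h g ≤ C₁ (a+3) M mA · a`
  have hS2 : ∫ t in Set.Icc 0 a, G t ≤ C₁ * (a + 3) * (M * mA) * a := by
    have h1 : ∀ t ∈ Set.Icc 0 a, ‖G t‖ ≤ C₁ * (a + 3) * (M * mA) := fun t ht ↦ by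
      rw [Real.norm_eq_abs, abs_of_nonneg (hG0 t)]
      have hta : |t| ≤ a := abs_le.mpr ⟨by linarith [ht.1], ht.2⟩
      calc G t = windowCount d t * g t := rfl
        _ ≤ C₁ * (|t| + 3) * (M * mA) := mul_le_mul (hwcle t) ((hgW t).trans
            (mul_le_mul_of_nonneg_left (hWsmall t hta) hM0)) (hg0 t) (by positivity)
        _ ≤ C₁ * (a + 3) * (M * mA) := by gcongr
    have h2 := norm_setIntegral_le_of_norm_le_const
      (measure_Icc_lt_top : volume (Set.Icc 0 a) < ⊤) h1
    rw [Real.volume_real_Icc_of_le ha0.le, sub_zero, Real.norm_eq_abs] at h2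
    exact (le_abs_self _).trans h2
  -- (S3) `∫_{(b,∞)} g ≤ M D T^{2B} b^{1−2B}`
  have hexp3 : -(2 * (B : ℝ)) < -1 := by linarith
  have hconv : ∀ t : ℝ, 0 < t → (T / t) ^ (2 * B) = T ^ (2 * B) * t ^ (-(2 * (B : ℝ))) := by
    intro t ht0
    rw [div_pow, Real.rpow_neg ht0.le, ← Real.rpow_natCast t (2 * B), Nat.cast_mul,
      Nat.cast_ofNat, div_eq_mul_inv]
  have hS3 : ∫ t in Set.Ioi b, g t ≤ M * (D * T ^ (2 * B)) * b ^ (-(2 * (B : ℝ)) + 1) := by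
    have hpt : ∀ t ∈ Set.Ioi b, g t ≤ M * (D * T ^ (2 * B)) * t ^ (-(2 * (B : ℝ))) := by
      intro t ht
      have hbt : b < t := ht
      have ht0 : 0 < t := by linarith
      have htabs : |t| = t := abs_of_pos ht0
      have h2T : 2 * T ≤ |t| := by rw [htabs]; linarith
      have hW := hD T t hT1 h2T
      rw [htabs] at hW
      calc g t ≤ M * weight w B T t := hgW t
        _ ≤ M * (D * (T / t) ^ (2 * B)) := mul_le_mul_of_nonneg_left hW hM0
        _ = M * (D * T ^ (2 * B)) * t ^ (-(2 * (B : ℝ))) := by rw [hconv t ht0]; ring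
    calc ∫ t in Set.Ioi b, g t
        ≤ ∫ t in Set.Ioi b, M * (D * T ^ (2 * B)) * t ^ (-(2 * (B : ℝ))) :=
          setIntegral_mono_on hg_int.integrableOn
            (Integrable.const_mul (integrableOn_Ioi_rpow_of_lt hexp3 hb0) _) measurableSet_Ioi hpt
      _ = M * (D * T ^ (2 * B)) * ∫ t in Set.Ioi b, t ^ (-(2 * (B : ℝ))) := integral_const_mul _ _
      _ ≤ M * (D * T ^ (2 * B)) * b ^ (-(2 * (B : ℝ)) + 1) := by
          rw [integral_Ioi_rpow_of_lt hexp3 hb0]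
          refine mul_le_mul_of_nonneg_left ?_ (by positivity)
          have hx := Real.rpow_nonneg hb0.le (-(2 * (B : ℝ)) + 1)
          generalize b ^ (-(2 * (B : ℝ)) + 1) = x at hx ⊢
          rw [div_le_iff_of_neg (by linarith only [hBR])]
          nlinarith only [hx, hBR]
  -- (S4) `∫_{(b,∞)} N_h g ≤ 4C₁ M D T^{2B} b^{2−2B}`
  have hexp4 : (1 - 2 * (B : ℝ)) < -1 := by linarith
  have hS4 : ∫ t in Set.Ioi b, G t ≤
      4 * C₁ * (M * (D * T ^ (2 * B))) * b ^ (1 - 2 * (B : ℝ) + 1) := by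
    have hpt : ∀ t ∈ Set.Ioi b, G t ≤ 4 * C₁ * (M * (D * T ^ (2 * B))) * t ^ (1 - 2 * (B : ℝ)) := by
      intro t ht
      have hbt : b < t := ht
      have ht0 : 0 < t := by linarith
      have ht1 : 1 ≤ t := by linarith
      have htabs : |t| = t := abs_of_pos ht0
      have h2T : 2 * T ≤ |t| := by rw [htabs]; linarith
      have hW := hD T t hT1 h2T
      rw [htabs] at hW
      have hsplit : t ^ (1 - 2 * (B : ℝ)) = t * t ^ (-(2 * (B : ℝ))) := by
        rw [sub_eq_add_neg, Real.rpow_add ht0, Real.rpow_one]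
      have hwc4 : windowCount d t ≤ C₁ * (4 * t) :=
        (hwcle t).trans (by rw [htabs]; nlinarith only [hC₁0, ht1])
      calc G t = windowCount d t * g t := rfl
        _ ≤ C₁ * (4 * t) * (M * (D * (T / t) ^ (2 * B))) :=
            mul_le_mul hwc4 ((hgW t).trans (mul_le_mul_of_nonneg_left hW hM0)) (hg0 t)
              (by positivity)
        _ = 4 * C₁ * (M * (D * T ^ (2 * B))) * t ^ (1 - 2 * (B : ℝ)) := by
            rw [hconv t ht0, hsplit]; ring
    calc ∫ t in Set.Ioi b, G t
        ≤ ∫ t in Set.Ioi b, 4 * C₁ * (M * (D * T ^ (2 * B))) * t ^ (1 - 2 * (B : ℝ)) :=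
          setIntegral_mono_on hG_int.integrableOn
            (Integrable.const_mul (integrableOn_Ioi_rpow_of_lt hexp4 hb0) _) measurableSet_Ioi hpt
      _ = 4 * C₁ * (M * (D * T ^ (2 * B))) * ∫ t in Set.Ioi b, t ^ (1 - 2 * (B : ℝ)) :=
          integral_const_mul _ _
      _ ≤ 4 * C₁ * (M * (D * T ^ (2 * B))) * b ^ (1 - 2 * (B : ℝ) + 1) := by
          rw [integral_Ioi_rpow_of_lt hexp4 hb0]
          refine mul_le_mul_of_nonneg_left ?_ (by positivity)
          have hx := Real.rpow_nonneg hb0.le (1 - 2 * (B : ℝ) + 1)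
          generalize b ^ (1 - 2 * (B : ℝ) + 1) = x at hx ⊢
          rw [div_le_iff_of_neg (by linarith only [hBR])]
          nlinarith only [hx, hBR]
  -- power-of-`T` conversions
  have haT' : a / T = T ^ (-ε) := by
    rw [ha_def, div_eq_mul_inv, ← Real.rpow_neg_one T, hTadd]
    congr 1; ring
  have hmA : mA = 2 ^ B * T ^ (-(2 * ε * B)) * (2 * CΦ ^ 2) := by
    have h1 : 2 * a ^ 2 / T ^ 2 = 2 * (a / T) ^ 2 := by ring
    have hexp : -ε * ((2 * B : ℕ) : ℝ) = -(2 * ε * B) := by push_cast; ring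
    rw [hmA_def, h1, haT', mul_pow, ← pow_mul, ← Real.rpow_mul_natCast hT0.le, hexp]
  have hTnat : (T ^ (2 * B) : ℝ) = T ^ (2 * (B : ℝ)) := by
    rw [← Real.rpow_natCast T (2 * B), Nat.cast_mul, Nat.cast_ofNat]
  have hbpow : ∀ x : ℝ, b ^ x = T ^ ((1 + ε) * x) := fun x ↦ by
    rw [hb_def, ← Real.rpow_mul hT0.le]
  have hapow2 : a ^ 2 = T ^ (2 - 2 * ε) := by
    rw [sq, ha_def, hTadd]; congr 1; ring
  -- the four error pieces are `≪ T^E`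
  have hE1 : M * mA * (2 * a) ≤ 4 * 2 ^ B * A ^ 2 * CΦ ^ 2 * T ^ E := by
    rw [hmA, hM_def]
    have h1 : T ^ (4 * CL) * T ^ (-(2 * ε * B)) * a ≤ T ^ E := by
      calc T ^ (4 * CL) * T ^ (-(2 * ε * B)) * a
          ≤ T ^ (4 * CL) * T ^ (-(2 * ε * B)) * T ^ (1 : ℝ) := by
            rw [Real.rpow_one]; exact mul_le_mul_of_nonneg_left haT (by positivity)
        _ = T ^ (4 * CL + -(2 * ε * B) + 1) := by rw [hTadd, hTadd]
        _ ≤ T ^ E := hTmono _ _ (by linarith only [hE_def])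
    calc A ^ 2 * T ^ (4 * CL) * (2 ^ B * T ^ (-(2 * ε * B)) * (2 * CΦ ^ 2)) * (2 * a)
        = 4 * 2 ^ B * A ^ 2 * CΦ ^ 2 * (T ^ (4 * CL) * T ^ (-(2 * ε * B)) * a) := by ring
      _ ≤ 4 * 2 ^ B * A ^ 2 * CΦ ^ 2 * T ^ E := mul_le_mul_of_nonneg_left h1 (by positivity)
  have hE2 : 2 * (M * (D * T ^ (2 * B)) * b ^ (-(2 * (B : ℝ)) + 1)) ≤ 2 * A ^ 2 * D * T ^ E := by
    rw [hM_def, hTnat, hbpow]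
    have h1 : T ^ (4 * CL) * T ^ (2 * (B : ℝ)) * T ^ ((1 + ε) * (-(2 * (B : ℝ)) + 1)) ≤ T ^ E := by
      rw [hTadd, hTadd]; exact hTmono _ _ (by linarith only [hE_def, hε1])
    calc 2 * (A ^ 2 * T ^ (4 * CL) * (D * T ^ (2 * (B : ℝ))) * T ^ ((1 + ε) * (-(2 * (B : ℝ)) + 1)))
        = 2 * A ^ 2 * D *
            (T ^ (4 * CL) * T ^ (2 * (B : ℝ)) * T ^ ((1 + ε) * (-(2 * (B : ℝ)) + 1))) := by ring
      _ ≤ 2 * A ^ 2 * D * T ^ E := mul_le_mul_of_nonneg_left h1 (by positivity)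
  have hE3 : C₁ * (a + 3) * (M * mA) * a ≤ 8 * 2 ^ B * C₁ * A ^ 2 * CΦ ^ 2 * T ^ E := by
    have ha3 : a + 3 ≤ 4 * a := by linarith
    have h0 : C₁ * (a + 3) * (M * mA) * a ≤ C₁ * (4 * a) * (M * mA) * a := by gcongr
    refine h0.trans ?_
    rw [hmA, hM_def]
    have h1 : a * a * (T ^ (4 * CL) * T ^ (-(2 * ε * B))) ≤ T ^ E := by
      rw [← sq, hapow2, hTadd, hTadd]; exact hTmono _ _ (by linarith only [hE_def, hε])
    calc C₁ * (4 * a) * (A ^ 2 * T ^ (4 * CL) * (2 ^ B * T ^ (-(2 * ε * B)) * (2 * CΦ ^ 2))) * a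
        = 8 * 2 ^ B * C₁ * A ^ 2 * CΦ ^ 2 * (a * a * (T ^ (4 * CL) * T ^ (-(2 * ε * B)))) := by
          ring
      _ ≤ 8 * 2 ^ B * C₁ * A ^ 2 * CΦ ^ 2 * T ^ E := mul_le_mul_of_nonneg_left h1 (by positivity)
  have hE4 : 4 * C₁ * (M * (D * T ^ (2 * B))) * b ^ (1 - 2 * (B : ℝ) + 1) ≤
      4 * C₁ * A ^ 2 * D * T ^ E := by
    rw [hM_def, hTnat, hbpow]
    have h1 : T ^ (4 * CL) * T ^ (2 * (B : ℝ)) * T ^ ((1 + ε) * (1 - 2 * (B : ℝ) + 1)) ≤ T ^ E := by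
      rw [hTadd, hTadd]; exact hTmono _ _ (by linarith only [hE_def, hε1])
    calc 4 * C₁ * (A ^ 2 * T ^ (4 * CL) * (D * T ^ (2 * (B : ℝ)))) *
          T ^ ((1 + ε) * (1 - 2 * (B : ℝ) + 1))
        = 4 * C₁ * A ^ 2 * D *
            (T ^ (4 * CL) * T ^ (2 * (B : ℝ)) * T ^ ((1 + ε) * (1 - 2 * (B : ℝ) + 1))) := by ring
      _ ≤ 4 * C₁ * A ^ 2 * D * T ^ E := mul_le_mul_of_nonneg_left h1 (by positivity)
  -- hence `e₀ ≤ Q₀ T^E`, `e₁ ≤ 4 C₁ Q₀ T^E`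
  have he₀0 : 0 ≤ e₀ := hdec₀.1
  have he₀ : e₀ ≤ Q₀ * T ^ E := by
    calc e₀ ≤ (∫ t in Set.Icc (-a) a, g t) + 2 * ∫ t in Set.Ioi b, g t := hdec₀.2
      _ ≤ M * mA * (2 * a) + 2 * (M * (D * T ^ (2 * B)) * b ^ (-(2 * (B : ℝ)) + 1)) := by
          linarith [hS1, hS3]
      _ ≤ 4 * 2 ^ B * A ^ 2 * CΦ ^ 2 * T ^ E + 2 * A ^ 2 * D * T ^ E := add_le_add hE1 hE2
      _ = Q₀ * T ^ E := by rw [hQ₀_def]; ring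
  have he₁0 : 0 ≤ e₁ := by rw [he₁_eq]; linarith [hdec₁.1]
  have he₁ : e₁ ≤ 4 * C₁ * Q₀ * T ^ E := by
    rw [he₁_eq]
    calc 2 * ((∫ t, G t) - I1 c ε w B r L T)
        ≤ 2 * ((∫ t in Set.Icc 0 a, G t) + ∫ t in Set.Ioi b, G t) := by linarith [hdec₁.2]
      _ ≤ 2 * (C₁ * (a + 3) * (M * mA) * a +
            4 * C₁ * (M * (D * T ^ (2 * B))) * b ^ (1 - 2 * (B : ℝ) + 1)) := by
          linarith [hS2, hS4]
      _ ≤ 2 * (8 * 2 ^ B * C₁ * A ^ 2 * CΦ ^ 2 * T ^ E + 4 * C₁ * A ^ 2 * D * T ^ E) := by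
          linarith [hE3, hE4]
      _ = 4 * C₁ * Q₀ * T ^ E := by rw [hQ₀_def]; ring
  -- `𝓘₁ ≤ 4 C₁ T² 𝓘₀`
  have hI1le : I1 c ε w B r L T ≤ 4 * C₁ * T ^ 2 * I0 ε w B r L T := by
    rw [hI1, hI0, ← integral_const_mul]
    refine setIntegral_mono_on hG_int.integrableOn (hg_int.const_mul _).integrableOn
      measurableSet_Icc fun t ht ↦ ?_
    have ht0 : 0 ≤ t := le_trans ha0.le ht.1
    have htT : |t| ≤ T ^ 2 := by rw [abs_of_nonneg ht0]; exact ht.2.trans hbT2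
    calc G t = windowCount d t * g t := rfl
      _ ≤ C₁ * (|t| + 3) * g t := mul_le_mul_of_nonneg_right (hwcle t) (hg0 t)
      _ ≤ 4 * C₁ * T ^ 2 * g t := by
          refine mul_le_mul_of_nonneg_right ?_ (hg0 t); nlinarith only [hC₁0, htT, hT21]
  -- positivity of `𝓘₀`
  have hTE1 : T ^ E ≤ T ^ (-1 : ℝ) := hTmono _ _ (by linarith)
  have he₀half : e₀ ≤ 1 / 2 := by
    have h1 : e₀ ≤ Q₀ * T ^ (-1 : ℝ) := he₀.trans (mul_le_mul_of_nonneg_left hTE1 hQ₀0)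
    rw [Real.rpow_neg_one] at h1
    have h2 : Q₀ * T⁻¹ ≤ 1 / 2 := by
      rw [← div_eq_mul_inv, div_le_iff₀ hT0]; linarith
    linarith
  have hI0pos : 0 < I0 ε w B r L T := by
    have : I0R w B r L T = 2 * I0 ε w B r L T + e₀ := by rw [he₀_def]; ring
    linarith
  refine ⟨hI0pos, ?_⟩
  -- the ratio estimate
  set i0 := I0 ε w B r L T with hi0_def
  set i1 := I1 c ε w B r L T with hi1_def
  set J0 := I0R w B r L T with hJ0_def
  set J1 := I1R c w B r L T with hJ1_def
  have hJ0 : J0 = 2 * i0 + e₀ := by rw [he₀_def]; ring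
  have hJ1 : J1 = 2 * i1 + e₁ := by rw [he₁_def]; ring
  have hJ0pos : 0 < J0 := by linarith
  have hi1nn : 0 ≤ i1 := by rw [hI1]; exact integral_nonneg fun t ↦ hG0 t
  have key : i1 / i0 - J1 / J0 = (i1 * e₀ - i0 * e₁) / (i0 * J0) := by
    rw [div_sub_div _ _ hI0pos.ne' hJ0pos.ne']
    congr 1
    rw [hJ1, hJ0]; ring
  rw [key, abs_div, abs_of_pos (mul_pos hI0pos hJ0pos)]
  have hx0 : 0 ≤ i1 * e₀ := mul_nonneg hi1nn he₀0
  have hy0 : 0 ≤ i0 * e₁ := mul_nonneg hI0pos.le he₁0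
  have hnum : |i1 * e₀ - i0 * e₁| ≤ i1 * e₀ + i0 * e₁ :=
    abs_sub_le_iff.mpr ⟨by linarith, by linarith⟩
  have hTE2 : T ^ 2 * T ^ E ≤ T ^ (-C) := by
    rw [← Real.rpow_two, hTadd]
    exact hTmono _ _ (by linarith)
  have hTE3 : T ^ E ≤ T ^ 2 * T ^ E := le_mul_of_one_le_left (hTpos E).le hT21
  have hfin1 : |i1 * e₀ - i0 * e₁| / (i0 * J0) ≤ (i1 * e₀ + i0 * e₁) / i0 :=
    (div_le_div_of_nonneg_right hnum (by positivity)).trans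
      (div_le_div_of_nonneg_left (by positivity) hI0pos (le_mul_of_one_le_right hI0pos.le hI0R1))
  have hfin2 : (i1 * e₀ + i0 * e₁) / i0 ≤ 4 * C₁ * T ^ 2 * e₀ + e₁ := by
    rw [div_le_iff₀ hI0pos]
    have h1 := mul_le_mul_of_nonneg_right hI1le he₀0
    linarith
  have hfin3 : 4 * C₁ * T ^ 2 * e₀ ≤ 4 * C₁ * T ^ 2 * (Q₀ * T ^ E) :=
    mul_le_mul_of_nonneg_left he₀ (by positivity)
  have hfin4 : 4 * C₁ * Q₀ * T ^ E ≤ 4 * C₁ * Q₀ * (T ^ 2 * T ^ E) :=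
    mul_le_mul_of_nonneg_left hTE3 (by positivity)
  have hfin5 : 8 * C₁ * Q₀ * (T ^ 2 * T ^ E) ≤ 8 * C₁ * Q₀ * T ^ (-C) :=
    mul_le_mul_of_nonneg_left hTE2 (by positivity)
  linarith only [hfin1, hfin2, hfin3, hfin4, hfin5, he₁]


/-! ### Appended (prover phase): DISCHARGE of (2) `supp Ŵ_T ⊆ [−2σ/T, 2σ/T]`

[cite: BondarenkoHeap2026, §2.1 (2) p. 5, TeX l.236–240]. `Φ = 𝓕⁻φ` with `φ` smooth, supported in
`(−σ, σ)`; hence `𝓕(Φ²) = φ ∗ φ` is supported in `[−2σ, 2σ]` (Mathlib's `Real.fourier_mul_convolution_eq`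
read backwards through Fourier inversion), `𝓕(Φ(·/T ± 1)²)(ξ) = T e^{±2πiTξ} 𝓕(Φ²)(Tξ)` vanishes for
`|ξ| ≥ 2σ/T`, and the polynomial prefactor `((t² + 1/4)/T²)^B` acts on the Fourier side as a
differential operator (`Real.iteratedDeriv_fourier`), which preserves vanishing on the open set
`{|ξ| > 2σ/T}`. NOT RH-BEARING. -/

namespace Support

open WeightCalculus
open scoped Convolution

/-- The Fourier integrand `e^{−2πivw} f(v)` is integrable when `f` is. [folklore] -/
private theorem integrable_exp_smul {f : ℝ → ℂ} (hf : Integrable f) (w : ℝ) :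
    Integrable fun v : ℝ ↦ Complex.exp (↑(-2 * π * v * w) * Complex.I) • f v := by
  have hcont : Continuous fun v : ℝ ↦ Complex.exp (↑(-2 * π * v * w) * Complex.I) := by
    fun_prop
  refine hf.bdd_mul (c := 1) hcont.aestronglyMeasurable (ae_of_all _ fun v ↦ ?_)
  rw [Complex.norm_exp_ofReal_mul_I]

/-- **Affine substitution on the Fourier side**: `𝓕[g(·/T + a)](w) = T e^{2πi T a w} 𝓕[g](Tw)`
for `T > 0`. [cite: BondarenkoHeap2026, §2.1 (2) p. 5] -/
theorem fourier_comp_div_add (g : ℝ → ℂ) {T : ℝ} (hT : 0 < T) (a w : ℝ) :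
    𝓕 (fun t : ℝ ↦ g (t / T + a)) w =
      (T : ℂ) * Complex.exp (↑(2 * π * T * a * w) * Complex.I) * 𝓕 g (T * w) := by
  rw [Real.fourier_real_eq_integral_exp_smul, Real.fourier_real_eq_integral_exp_smul]
  set G : ℝ → ℂ := fun u ↦ Complex.exp (↑(-2 * π * (T * u) * w) * Complex.I) • g (u + a) with hG
  have h1 : (fun v : ℝ ↦ Complex.exp (↑(-2 * π * v * w) * Complex.I) • g (v / T + a)) =
      fun v ↦ G (T⁻¹ * v) := by
    funext v
    have hv : T * (v / T) = v := by field_simp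
    simp only [hG, inv_mul_eq_div, hv]
  rw [h1, Measure.integral_comp_inv_mul_left, abs_of_pos hT, ← integral_sub_right_eq_self G a]
  have h2 : (fun s : ℝ ↦ G (s - a)) = fun s ↦ Complex.exp (↑(2 * π * T * a * w) * Complex.I) *
      (Complex.exp (↑(-2 * π * s * (T * w)) * Complex.I) • g s) := by
    funext s
    simp only [hG, sub_add_cancel, smul_eq_mul]
    rw [show Complex.exp (↑(2 * π * T * a * w) * Complex.I) *
        (Complex.exp (↑(-2 * π * s * (T * w)) * Complex.I) * g s) =
        (Complex.exp (↑(2 * π * T * a * w) * Complex.I) *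
          Complex.exp (↑(-2 * π * s * (T * w)) * Complex.I)) * g s by ring, ← Complex.exp_add]
    congr 1
    congr 1
    push_cast; ring
  rw [h2, integral_const_mul, Complex.real_smul]
  ring

/-- **`𝓕(𝓕⁻F · 𝓕⁻G) = F ∗ G`** for Schwartz `F, G` (the convolution theorem
`Real.fourier_mul_convolution_eq` read through Fourier inversion). [cite: BondarenkoHeap2026, §2.1 (2) p. 5] -/
theorem fourier_mul_fourierInv (F G : SchwartzMap ℝ ℂ) :
    𝓕 (fun x : ℝ ↦ 𝓕⁻ (F : ℝ → ℂ) x * 𝓕⁻ (G : ℝ → ℂ) x) =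
      (F : ℝ → ℂ) ⋆[ContinuousLinearMap.mul ℂ ℂ] (G : ℝ → ℂ) := by
  have hconv : ∀ ξ : ℝ, 𝓕 ((F : ℝ → ℂ) ⋆[ContinuousLinearMap.mul ℂ ℂ] (G : ℝ → ℂ)) ξ =
      𝓕 (F : ℝ → ℂ) ξ * 𝓕 (G : ℝ → ℂ) ξ := fun ξ ↦
    Real.fourier_mul_convolution_eq F.integrable G.integrable ξ
  have hpt : (fun x : ℝ ↦ 𝓕⁻ (F : ℝ → ℂ) x * 𝓕⁻ (G : ℝ → ℂ) x) =
      𝓕⁻ ((F : ℝ → ℂ) ⋆[ContinuousLinearMap.mul ℂ ℂ] (G : ℝ → ℂ)) := by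
    funext x
    rw [Real.fourierInv_eq_fourier_neg, Real.fourierInv_eq_fourier_neg,
      Real.fourierInv_eq_fourier_neg, hconv]
  rw [hpt]
  refine Continuous.fourier_fourierInv_eq ?_ (F.integrable.integrable_convolution _ G.integrable) ?_
  · exact BddAbove.continuous_convolution_right_of_integrable (ContinuousLinearMap.mul ℂ ℂ)
      ⟨SchwartzMap.seminorm ℝ 0 0 G, fun x ⟨y, hy⟩ ↦ hy ▸ SchwartzMap.norm_le_seminorm ℝ G y⟩
      F.integrable G.continuous
  · have h : 𝓕 ((F : ℝ → ℂ) ⋆[ContinuousLinearMap.mul ℂ ℂ] (G : ℝ → ℂ)) =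
        fun ξ ↦ (𝓕 F) ξ * (𝓕 G) ξ := by
      funext ξ; rw [hconv, SchwartzMap.fourier_coe, SchwartzMap.fourier_coe]
    rw [h]
    refine ((SchwartzMap.pairing (ContinuousLinearMap.mul ℂ ℂ) (𝓕 F) (𝓕 G)).integrable
      (μ := volume)).congr (ae_of_all _ fun ξ ↦ ?_)
    rw [SchwartzMap.pairing_apply_apply, ContinuousLinearMap.mul_apply']

/-- `φ ∗ φ` vanishes off `(−2σ, 2σ)` when `φ` vanishes off `(−σ, σ)`. [cite: BondarenkoHeap2026, §2.1 (2) p. 5] -/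
theorem convolution_eq_zero_of_support {φ : ℝ → ℂ} {σ : ℝ} (hφ : ∀ x, σ ≤ |x| → φ x = 0)
    {η : ℝ} (hη : 2 * σ ≤ |η|) : (φ ⋆[ContinuousLinearMap.mul ℂ ℂ] φ) η = 0 := by
  rw [convolution_def]
  refine integral_eq_zero_of_ae (Eventually.of_forall fun s ↦ ?_)
  simp only [ContinuousLinearMap.mul_apply', Pi.zero_apply]
  by_cases hs : σ ≤ |s|
  · rw [hφ s hs, zero_mul]
  · rw [hφ (η - s) ?_, mul_zero]
    have h1 := abs_sub_abs_le_abs_sub η s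
    have hs' := not_le.mp hs
    linarith

/-- `φ(x) = 0` for `|x| ≥ σ` (the support hypothesis of the bump). [cite: BondarenkoHeap2026, §2.1 p. 5 (φ and σ)] -/
theorem phiC_eq_zero (w : Bump) {x : ℝ} (hx : w.σ ≤ |x|) : (w.φ x : ℂ) = 0 := by
  have hx' : x ∉ tsupport w.φ := fun h ↦ by
    have h2 := w.tsupport_subset h
    rw [Set.mem_Ioo] at h2
    have := abs_lt.mpr ⟨h2.1, h2.2⟩
    linarith
  rw [image_eq_zero_of_notMem_tsupport hx', Complex.ofReal_zero]

/-- **`𝓕(Φ²)(η) = (φ ∗ φ)(η) = 0` for `|η| ≥ 2σ`.** [cite: BondarenkoHeap2026, §2.1 (2) p. 5] -/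
theorem fourier_Phi_sq_eq_zero (w : Bump) {η : ℝ} (hη : 2 * w.σ ≤ |η|) :
    𝓕 (fun x : ℝ ↦ (Phi w x : ℂ) * (Phi w x : ℂ)) η = 0 := by
  set φs : SchwartzMap ℝ ℂ := (hasCompactSupport_phiC w).toSchwartzMap (contDiff_phiC w) with hφs
  have hcoe : (φs : ℝ → ℂ) = fun ξ ↦ (w.φ ξ : ℂ) := rfl
  have h1 : (fun x : ℝ ↦ (Phi w x : ℂ) * (Phi w x : ℂ)) =
      fun x ↦ 𝓕⁻ (φs : ℝ → ℂ) x * 𝓕⁻ (φs : ℝ → ℂ) x := by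
    funext x; rw [Phi_eq, hcoe]
  rw [h1, fourier_mul_fourierInv φs φs, hcoe]
  exact convolution_eq_zero_of_support (fun x hx ↦ phiC_eq_zero w hx) hη

/-- **`𝓕(Φ(·/T + a)²)(ξ) = 0` for `|ξ| ≥ 2σ/T`** (`T > 0`). [cite: BondarenkoHeap2026, §2.1 (2) p. 5] -/
theorem fourier_Phi_sq_comp_eq_zero (w : Bump) {T : ℝ} (hT : 0 < T) (a : ℝ) {ξ : ℝ}
    (hξ : 2 * w.σ / T ≤ |ξ|) :
    𝓕 (fun t : ℝ ↦ ((Phi w (t / T + a) : ℂ)) ^ 2) ξ = 0 := by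
  have h1 : (fun t : ℝ ↦ ((Phi w (t / T + a) : ℂ)) ^ 2) =
      fun t ↦ (Phi w (t / T + a) : ℂ) * (Phi w (t / T + a) : ℂ) := by
    funext t; rw [sq]
  rw [h1, fourier_comp_div_add (fun x : ℝ ↦ (Phi w x : ℂ) * (Phi w x : ℂ)) hT a ξ,
    fourier_Phi_sq_eq_zero w ?_, mul_zero]
  rw [abs_mul, abs_of_pos hT]
  rwa [div_le_iff₀' hT] at hξ

/-- The moments `x^n Φ(x/T + a)²` (complex-valued) are integrable (`T ≠ 0`).
[cite: BondarenkoHeap2026, §2.1 (2) p. 5] -/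
theorem integrable_pow_smul_Phi_sq_comp (w : Bump) {T : ℝ} (hT : T ≠ 0) (n : ℕ) (a : ℝ) :
    Integrable fun x : ℝ ↦ x ^ n • ((Phi w (x / T + a) : ℂ)) ^ 2 := by
  have hre : Integrable fun x : ℝ ↦ x ^ n * Phi w (x / T + a) ^ 2 := by
    have h1 := ((integrable_pow_mul_Phi_sq w n a).comp_mul_left' (inv_ne_zero hT)).const_mul (T ^ n)
    refine h1.congr (ae_of_all _ fun x ↦ ?_)
    simp only [inv_mul_eq_div]
    rw [div_pow, ← mul_assoc, ← mul_div_assoc, mul_div_cancel_left₀ _ (pow_ne_zero n hT)]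
  refine (hre.ofReal (𝕜 := ℂ)).congr (ae_of_all _ fun x ↦ ?_)
  show ((x ^ n * Phi w (x / T + a) ^ 2 : ℝ) : ℂ) = x ^ n • ((Phi w (x / T + a) : ℂ)) ^ 2
  rw [Complex.real_smul]
  push_cast
  ring

end Support

open Support WeightCalculus in
/-- **DISCHARGE of (2): `supp Ŵ_T ⊆ [−2σ/T, 2σ/T]`** — `𝓕 W_T(ξ) = 0` for `|ξ| > 2σ/T` (`T > 0`).
With `h(t) = Φ(t/T−1)² + Φ(t/T+1)²`: `𝓕h` vanishes on the open set `U = {|ξ| > 2σ/T}`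
(`Support.fourier_Phi_sq_comp_eq_zero`), hence so do all `iteratedDeriv m (𝓕 h)` on `U`; by
`Real.iteratedDeriv_fourier`, `𝓕[(−2πit)^m h](ξ) = (𝓕h)^{(m)}(ξ) = 0` there, and
`W_T(t) = Σ_j d_j (−2πit)^{2j} h(t)` with `d_j = C(B,j) 4^{−(B−j)} T^{−2B} (−2πi)^{−2j}`.
[cite: BondarenkoHeap2026, §2.1 (2) p. 5, TeX l.236–240] -/
theorem weightHat_support_holds : weightHat_support := by
  intro w B T hT ξ hξ
  have hT0 : T ≠ 0 := hT.ne'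
  set h : ℝ → ℂ := fun t ↦ ((Phi w (t / T - 1) : ℂ)) ^ 2 + ((Phi w (t / T + 1) : ℂ)) ^ 2
    with hh_def
  -- integrability of the moments of `h`
  have hmom : ∀ n : ℕ, Integrable fun x : ℝ ↦ x ^ n • h x := fun n ↦ by
    have := (integrable_pow_smul_Phi_sq_comp w hT0 n (-1)).add
      (integrable_pow_smul_Phi_sq_comp w hT0 n 1)
    refine this.congr (ae_of_all _ fun x ↦ ?_)
    simp only [hh_def, Pi.add_apply, smul_add, ← sub_eq_add_neg]
  -- `𝓕 h` vanishes on `U = {ζ | 2σ/T < |ζ|}`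
  have hFh : ∀ ζ : ℝ, 2 * w.σ / T ≤ |ζ| → 𝓕 h ζ = 0 := by
    intro ζ hζ
    have hi1 : Integrable fun t : ℝ ↦ ((Phi w (t / T + (-1)) : ℂ)) ^ 2 := by
      simpa using integrable_pow_smul_Phi_sq_comp w hT0 0 (-1)
    have hi2 : Integrable fun t : ℝ ↦ ((Phi w (t / T + 1) : ℂ)) ^ 2 := by
      simpa using integrable_pow_smul_Phi_sq_comp w hT0 0 1
    have z1 := fourier_Phi_sq_comp_eq_zero w hT (-1) hζ
    have z2 := fourier_Phi_sq_comp_eq_zero w hT 1 hζ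
    rw [Real.fourier_real_eq_integral_exp_smul] at z1 z2 ⊢
    have e2 : (fun v : ℝ ↦ Complex.exp (↑(-2 * π * v * ζ) * Complex.I) • h v) = fun v : ℝ ↦
        Complex.exp (↑(-2 * π * v * ζ) * Complex.I) • ((Phi w (v / T + (-1)) : ℂ)) ^ 2 +
        Complex.exp (↑(-2 * π * v * ζ) * Complex.I) • ((Phi w (v / T + 1) : ℂ)) ^ 2 := by
      funext v
      simp only [hh_def, smul_add, ← sub_eq_add_neg]
    rw [e2, integral_add (integrable_exp_smul hi1 ζ) (integrable_exp_smul hi2 ζ), z1, z2, add_zero]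
  -- all `t`-moments of `h` have vanishing Fourier transform at `ξ`
  have hU : IsOpen {ζ : ℝ | 2 * w.σ / T < |ζ|} := isOpen_lt continuous_const continuous_abs
  have hderiv : ∀ m : ℕ, 𝓕 (fun x : ℝ ↦ (-2 * (π : ℂ) * Complex.I * (x : ℂ)) ^ m • h x) ξ = 0 := by
    intro m
    have hid := Real.iteratedDeriv_fourier (f := h) (N := ⊤) (n := m) (fun n _ ↦ hmom n) le_top
    have hev : 𝓕 h =ᶠ[nhds ξ] fun _ ↦ (0 : ℂ) :=
      Filter.eventually_of_mem (hU.mem_nhds hξ) fun ζ hζ ↦ hFh ζ (le_of_lt hζ)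
    have h0 : iteratedDeriv m (𝓕 h) ξ = 0 := by
      rw [Filter.EventuallyEq.iteratedDeriv_eq m hev]
      simp
    rw [hid] at h0
    exact h0
  -- `W_T` as a combination of the moments `(−2πit)^{2j} h(t)`
  have hπ : (-2 * (π : ℂ) * Complex.I) ≠ 0 := by
    simp [Real.pi_ne_zero, Complex.I_ne_zero]
  have hTC : (T : ℂ) ≠ 0 := Complex.ofReal_ne_zero.mpr hT0
  set d : ℕ → ℂ := fun j ↦ ((T : ℂ) ^ (2 * B))⁻¹ * (B.choose j : ℂ) * (1 / 4 : ℂ) ^ (B - j) *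
    ((-2 * (π : ℂ) * Complex.I) ^ (2 * j))⁻¹ with hd_def
  have hW : (fun t : ℝ ↦ (weight w B T t : ℂ)) = fun t : ℝ ↦ ∑ j ∈ Finset.range (B + 1),
      d j * ((-2 * (π : ℂ) * Complex.I * (t : ℂ)) ^ (2 * j) • h t) := by
    funext t
    simp only [weight, hh_def, hd_def, smul_eq_mul]
    push_cast
    rw [div_pow, add_pow, Finset.sum_div, Finset.sum_mul]
    refine Finset.sum_congr rfl fun j _ ↦ ?_
    have hπj : (-2 * (π : ℂ) * Complex.I) ^ (2 * j) ≠ 0 := pow_ne_zero _ hπ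
    rw [mul_pow (-2 * (π : ℂ) * Complex.I) (t : ℂ) (2 * j), pow_mul (t : ℂ) 2 j]
    field_simp
    ring
  -- conclude by linearity of `𝓕` (as an integral)
  rw [hW, Real.fourier_real_eq_integral_exp_smul]
  have hq : ∀ j : ℕ, Integrable fun x : ℝ ↦ (-2 * (π : ℂ) * Complex.I * (x : ℂ)) ^ (2 * j) • h x := by
    intro j
    have := (hmom (2 * j)).const_mul ((-2 * (π : ℂ) * Complex.I) ^ (2 * j))
    refine this.congr (ae_of_all _ fun x ↦ ?_)
    show (-2 * (π : ℂ) * Complex.I) ^ (2 * j) * (x ^ (2 * j) • h x) =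
      (-2 * (π : ℂ) * Complex.I * (x : ℂ)) ^ (2 * j) • h x
    rw [Complex.real_smul, smul_eq_mul, mul_pow]
    push_cast
    ring
  have hqi : ∀ j : ℕ, Integrable fun v : ℝ ↦ Complex.exp (↑(-2 * π * v * ξ) * Complex.I) •
      (d j * ((-2 * (π : ℂ) * Complex.I * (v : ℂ)) ^ (2 * j) • h v)) := fun j ↦
    integrable_exp_smul ((hq j).const_mul (d j)) ξ
  have e3 : (fun v : ℝ ↦ Complex.exp (↑(-2 * π * v * ξ) * Complex.I) •
      ∑ j ∈ Finset.range (B + 1), d j * ((-2 * (π : ℂ) * Complex.I * (v : ℂ)) ^ (2 * j) • h v)) =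
      fun v : ℝ ↦ ∑ j ∈ Finset.range (B + 1), Complex.exp (↑(-2 * π * v * ξ) * Complex.I) •
        (d j * ((-2 * (π : ℂ) * Complex.I * (v : ℂ)) ^ (2 * j) • h v)) := by
    funext v; rw [Finset.smul_sum]
  rw [e3, integral_finsetSum _ fun j _ ↦ hqi j]
  refine Finset.sum_eq_zero fun j _ ↦ ?_
  have e4 : (fun v : ℝ ↦ Complex.exp (↑(-2 * π * v * ξ) * Complex.I) •
      (d j * ((-2 * (π : ℂ) * Complex.I * (v : ℂ)) ^ (2 * j) • h v))) =
      fun v : ℝ ↦ d j * (Complex.exp (↑(-2 * π * v * ξ) * Complex.I) •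
        ((-2 * (π : ℂ) * Complex.I * (v : ℂ)) ^ (2 * j) • h v)) := by
    funext v; simp only [smul_eq_mul]; ring
  have z := hderiv (2 * j)
  rw [Real.fourier_real_eq_integral_exp_smul] at z
  rw [e4, integral_const_mul, z, mul_zero]

end BondarenkoHeap2026

end Literature.NumberTheory.LFunctions

end
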